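/-
Copyright: pub-rosobs cell (Resolution Observatory), carver gen 40.  Companion file; statements OURS, in
the cell's polynomial weighted-centre model `W(f)`.  Instrument — NOT a resolution theorem.
-/
import Literature.AlgebraicGeometry.Resolution.WeightedCentreUmbrellaPowSecondVertex
import HarnessLib

/-!
# `max W(v² + w^m u + z³) = (2, 3, m+1, m+1)` — the second vertex of a cube-umbrella

For `f = X_i² + X_j^m X_l + X_e³` (`i, j, l, e` distinct indices among `N`, any number of spectator
variables, `m ≥ 3`, ALL polynomial coordinate changes `Ψ`) we prove, in the cell's polynomial model
`W(f) = {exps γ : (Ψ, γ) an admissible centre for f}` of [AbramovichTemkinWlodarczyk2024, Thm. 5.3.1 (2)]: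

* `(2, 3, m+1, m+1) ∈ W(f)` (the coordinate centre `(X_i², X_e³, X_j^{m+1}, X_l^{m+1})`);
* first face: nothing in `W(f)` is above `(2, 3)` (Hironaka's `δ(f; X_i) = 3/2 ∉ ℕ`, vertex theorems of
  `WeightedCentreVertexPreparation`);
* **second vertex** (`not_isCentreFor_umbrellaCube_vertex`, weight form; `not_isCentreFor_umbrellaCube_of_exps`,
  invariant form): no centre has weights `γ_a = 1/2`, `γ_b = 1/3`, one weight `γ_d ≤ 1/(m+1)` on a third
  variable and all other weights `≤ q/p` with `(m+1) q < p` — equivalently no invariant `(2, 3, t…)` with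
  `(m+1, m+1) <_trunc t` — provided `2 ≠ 0` in `k` or `m` is even, and `3 ≠ 0` in `k` or `3 ∤ m + 1`;
* hence **`IsMaxInv W(f) (2, 3, m+1, m+1)`** (`isMaxInv_umbrellaCube`); for the census shape
  `v² + w⁶ u + z³` (`m = 6`) this holds in EVERY characteristic (`isMaxInv_umbrellaCube_six`).

Method (second vertex).  Let `κ` kill `X_a, X_b` and `ρ = κ ∘ Ψ⁻¹`.  The Taylor maps
`X_x ↦ ρ(X_x) + ε ρ(ξ_x)` along the vector fields `∂_i` and `ξ = (∂_i v')∂_e − (∂_e v')∂_i`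
(`v' = Ψ X_a`, so `ξ v' = 0`) send `f = Ψ(Ψ⁻¹ f)` to polynomials all of whose `ε^j`-slices have large
weighted order for the integer weights `6p` on `X_d`, `6(m+1)q` elsewhere: admissibility of `Ψ⁻¹ f`
transfers through the images of the generators (`SliceOrd.map`).  Reading the `ε⁰`-slice in the degree
grading (components of degree `2`, `3` and `m+1`; a monomial of degree `≤ m+1` and weight `≥ 6(m+1)p` is
`X_d^{m+1}`) gives `lin ρ(X_i) = lin ρ(X_e) = 0` and `(lin ρ X_j)^m · lin ρ(X_l) = κ' X_d^{m+1}`, the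
`ε¹, ε²`-slices supplying the orders of `ρ(X_i)` and `ρ(X_e)` needed on the way; an elementary trichotomy
on linear forms (`linForm_trichotomy`) and the rank of the Jacobian of `Ψ⁻¹` at the origin
(`false_of_jacobian_rows_supported`) finish the proof.  In characteristic `2` (resp. `3`) the missing
derivative information on `ρ(X_i)` (resp. `ρ(X_e)`) is replaced by the parity of the degrees of squares
(resp. cubes), whence the hypotheses `m` even (resp. `3 ∤ m+1`) there.  Whether these parity hypotheses
are necessary is not decided here (not treated).

References: [AbramovichTemkinWlodarczyk2024, Thm. 5.3.1 (2) (p. 1578), Lemma 5.2.6–5.2.10 (p. 1577), §3.4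
(p. 1570)]; [CossartJannsenSaito2020, §2.2 (p. 21), Def. 7.1 (p. 107), Thm. 8.16 (p. 121)]; [Temkin2025,
§1.2.2 (p. 4)].  Statements ours (the cell's model) — NOT a resolution theorem, NOT summit progress.
-/

open MvPolynomial

namespace Literature.AlgebraicGeometry.Resolution.WeightedBlowup

variable {k : Type*} [Field k] {N : ℕ}

/-! ## §1 The germ `X_i² + X_j^m X_l + X_e³` and its Newton data -/

section Germ

variable (k) in
/-- `X_i² + X_j^m X_l + X_e³`: the umbrella `umbrella k i j l 2 m` plus a cube (spectators allowed).
(construction) [cite: Temkin2025, §1.2.2 (1) (p. 4) (umbrella-type germs in positive characteristic)] -/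
noncomputable def umbrellaCube (i j l e : Fin N) (m : ℕ) : MvPolynomial (Fin N) k :=
  umbrella k i j l 2 m + X e ^ 3

variable {i j l e : Fin N} {m : ℕ}

/-- `umbrellaCube = X_i² + X_j^m X_l + X_e³` (plumbing). [cite: Temkin2025, §1.2.2 (1) (p. 4)] -/
theorem umbrellaCube_eq : umbrellaCube k i j l e m = X i ^ 2 + X j ^ m * X l + X e ^ 3 := by
  rw [umbrellaCube, umbrella]

/-- The germ as a sum of three monomials (plumbing). [folklore] -/
private theorem umbrellaCube_eq_sum :
    umbrellaCube k i j l e m =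
      monomial (Finsupp.single i 2) 1 + monomial (umbExp j l m) 1 + monomial (Finsupp.single e 3) 1 := by
  rw [umbrellaCube_eq, umbExp, X_pow_eq_monomial, X_pow_eq_monomial, X_pow_eq_monomial,
    ← pow_one (X l : MvPolynomial (Fin N) k), X_pow_eq_monomial, monomial_mul, mul_one]

/-- Exponent bookkeeping (plumbing). [folklore] -/
private theorem umbExp_apply' (x : Fin N) :
    umbExp j l m x = (if j = x then m else 0) + (if l = x then 1 else 0) := by
  rw [umbExp, Finsupp.add_apply, Finsupp.single_apply, Finsupp.single_apply]

/-- The three exponents are distinct (plumbing). [folklore] -/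
private theorem single_two_ne_umbExp' (hil : i ≠ l) (hjl : j ≠ l) : Finsupp.single i 2 ≠ umbExp j l m := by
  intro h
  have := congrArg (fun d => d l) h
  simp only [Finsupp.single_apply, if_neg hil, umbExp_apply', if_neg hjl, if_true] at this
  omega

/-- The three exponents are distinct (plumbing). [folklore] -/
private theorem single_two_ne_single_three (hie : i ≠ e) :
    Finsupp.single i 2 ≠ (Finsupp.single e 3 : Fin N →₀ ℕ) := by
  intro h
  have := congrArg (fun d => d i) h
  simp only [Finsupp.single_apply, if_true, if_neg (Ne.symm hie)] at this
  omega

/-- The three exponents are distinct (plumbing). [folklore] -/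
private theorem umbExp_ne_single_three (hle : l ≠ e) : umbExp j l m ≠ Finsupp.single e 3 := by
  intro h
  have := congrArg (fun d => d l) h
  simp only [umbExp_apply', if_true, Finsupp.single_apply, if_neg (Ne.symm hle)] at this
  omega

/-- Support of the germ (plumbing). [folklore] -/
private theorem mem_support_umbrellaCube {d : Fin N →₀ ℕ} (hd : d ∈ (umbrellaCube k i j l e m).support) :
    d = Finsupp.single i 2 ∨ d = umbExp j l m ∨ d = Finsupp.single e 3 := by
  rw [umbrellaCube_eq_sum] at hd
  rcases Finset.mem_union.1 (support_add hd) with h1 | h1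
  · rcases Finset.mem_union.1 (support_add h1) with h2 | h2
    · exact Or.inl (Finset.mem_singleton.1 (support_monomial_subset h2))
    · exact Or.inr (Or.inl (Finset.mem_singleton.1 (support_monomial_subset h2)))
  · exact Or.inr (Or.inr (Finset.mem_singleton.1 (support_monomial_subset h1)))

/-- Coefficients of the germ (plumbing). [folklore] -/
private theorem coeff_single_two_umbrellaCube (hil : i ≠ l) (hie : i ≠ e) (hjl : j ≠ l) :
    coeff (Finsupp.single i 2) (umbrellaCube k i j l e m) = 1 := by
  rw [umbrellaCube_eq_sum, coeff_add, coeff_add, coeff_monomial, coeff_monomial, coeff_monomial, if_pos rfl,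
    if_neg (single_two_ne_umbExp' hil hjl).symm, if_neg (single_two_ne_single_three hie).symm, add_zero,
    add_zero]

/-- Coefficients of the germ (plumbing). [folklore] -/
private theorem coeff_umbExp_umbrellaCube (hil : i ≠ l) (hjl : j ≠ l) (hle : l ≠ e) :
    coeff (umbExp j l m) (umbrellaCube k i j l e m) = 1 := by
  rw [umbrellaCube_eq_sum, coeff_add, coeff_add, coeff_monomial, coeff_monomial, coeff_monomial,
    if_neg (single_two_ne_umbExp' hil hjl), if_pos rfl, if_neg (umbExp_ne_single_three hle).symm, zero_add,
    add_zero]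

/-- Coefficients of the germ (plumbing). [folklore] -/
private theorem coeff_single_three_umbrellaCube (hie : i ≠ e) (hle : l ≠ e) :
    coeff (Finsupp.single e 3) (umbrellaCube k i j l e m) = 1 := by
  rw [umbrellaCube_eq_sum, coeff_add, coeff_add, coeff_monomial, coeff_monomial, coeff_monomial,
    if_neg (single_two_ne_single_three hie), if_neg (umbExp_ne_single_three hle), if_pos rfl, zero_add,
    zero_add]

/-- Degree of the umbrella exponent (plumbing). [folklore] -/
private theorem degree_umbExp' (j l : Fin N) (m : ℕ) : (umbExp j l m).degree = m + 1 := by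
  rw [umbExp, map_add, Finsupp.degree_single, Finsupp.degree_single]

/-- The germ is non-zero (plumbing). [folklore] -/
private theorem umbrellaCube_ne_zero (hie : i ≠ e) (hle : l ≠ e) : umbrellaCube k i j l e m ≠ 0 := by
  intro h0
  have := coeff_single_three_umbrellaCube (k := k) (j := j) (m := m) hie hle
  rw [h0, coeff_zero] at this
  exact zero_ne_one this

/-- **The order of `X_i² + X_j^m X_l + X_e³` is `2`** (`m ≥ 1`).
[cite: AbramovichTemkinWlodarczyk2024, §5.1 (p. 1575) (a₁ = ord)] -/
theorem monomialOrd_umbrellaCube (hil : i ≠ l) (hie : i ≠ e) (hjl : j ≠ l) (hm : 1 ≤ m) :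
    monomialOrd (fun _ => 1) (umbrellaCube k i j l e m) = 2 := by
  apply le_antisymm
  · have hmem : Finsupp.single i 2 ∈ (umbrellaCube k i j l e m).support := by
      rw [mem_support_iff, coeff_single_two_umbrellaCube hil hie hjl]; exact one_ne_zero
    refine (monomialOrd_le_weight (fun _ => 1) hmem).trans ?_
    rw [← Finsupp.degree_eq_weight_one, Finsupp.degree_single]
    simp
  · rw [show (2 : ℕ∞) = ((2 : ℕ) : ℕ∞) from rfl, le_monomialOrd_one_iff]
    intro d hd
    rcases mem_support_umbrellaCube hd with rfl | rfl | rfl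
    · rw [Finsupp.degree_single]
    · rw [degree_umbExp']; omega
    · rw [Finsupp.degree_single]; norm_num

/-- **The initial form is `X_i²`** (`m ≠ 1`). [cite: CossartJannsenSaito2020, Def. 8.2 (p. 118) (in_ν f)] -/
theorem homogeneousComponent_umbrellaCube (hm : m ≠ 1) :
    homogeneousComponent 2 (umbrellaCube k i j l e m) = X i ^ 2 := by
  rw [umbrellaCube, map_add, homogeneousComponent_umbrella (by omega),
    homogeneousComponent_of_mem (isHomogeneous_X_pow e 3), if_neg (by norm_num), add_zero]

/-- `3/2` is not a natural number (plumbing). [folklore] -/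
private theorem natCast_ne_three_halves' (n : ℕ) : (n : ℚ) ≠ 3 / 2 := by
  intro h
  have h2 : (2 * n : ℕ) = (3 : ℕ) := by
    have : (2 : ℚ) * n = 3 := by rw [h]; norm_num
    exact_mod_cast this
  omega

/-- **Hironaka's `δ` with respect to `X_i` is `3/2`** (`m ≥ 2`): the points of the polyhedron are
`(m+1)/2` (from `X_j^m X_l`) and `3/2` (from `X_e³`). [cite: CossartJannsenSaito2020, Def. 8.2 (1) (p. 118)] -/
theorem hironakaDelta_umbrellaCube (hij : i ≠ j) (hil : i ≠ l) (hie : i ≠ e) (hle : l ≠ e) (hm : 2 ≤ m) :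
    hironakaDelta {i} 2 (umbrellaCube k i j l e m) = (((3 : ℚ) / 2 : ℚ) : WithTop ℚ) := by
  classical
  have hbU : blockDeg {i} (umbExp j l m) = 0 := by
    rw [blockDeg_singleton, umbExp_apply', if_neg (Ne.symm hij), if_neg (Ne.symm hil)]
  have hcU : coDeg {i} (umbExp j l m) = m + 1 := by
    rw [coDeg_singleton, degree_umbExp', umbExp_apply', if_neg (Ne.symm hij), if_neg (Ne.symm hil)]; rfl
  have hbE : blockDeg {i} (Finsupp.single e 3 : Fin N →₀ ℕ) = 0 := by
    rw [blockDeg_singleton, Finsupp.single_apply, if_neg (Ne.symm hie)]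
  have hcE : coDeg {i} (Finsupp.single e 3 : Fin N →₀ ℕ) = 3 := by
    rw [coDeg_singleton, Finsupp.degree_single, Finsupp.single_apply, if_neg (Ne.symm hie)]; rfl
  apply le_antisymm
  · unfold hironakaDelta
    have hmem : Finsupp.single e 3 ∈ (umbrellaCube k i j l e m).support := by
      rw [mem_support_iff, coeff_single_three_umbrellaCube hie hle]; exact one_ne_zero
    refine (Finset.inf_le (Finset.mem_filter.2 ⟨hmem, ?_⟩)).trans ?_
    · rw [hbE]; exact two_pos
    · rw [hbE, hcE]; norm_num
  · rw [le_hironakaDelta_iff]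
    intro d hd hb
    rcases mem_support_umbrellaCube hd with rfl | rfl | rfl
    · rw [blockDeg_singleton, Finsupp.single_eq_same] at hb; exact (lt_irrefl _ hb).elim
    · rw [hbU, hcU, Nat.sub_zero]
      have : (2 : ℚ) ≤ m := by exact_mod_cast hm
      push_cast
      linarith
    · rw [hbE, hcE]; norm_num

/-- `δ = 3/2 ∉ ℕ`, so the germ is `δ`-prepared with respect to `X_i` for free (`m ≥ 2`). (derived here)
[cite: CossartJannsenSaito2020, Thm. 8.22 (a) (p. 124) (solvable vertices are integral)] -/
theorem isDeltaPrepared_umbrellaCube (hij : i ≠ j) (hil : i ≠ l) (hie : i ≠ e) (hle : l ≠ e) (hm : 2 ≤ m) :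
    IsDeltaPrepared {i} 2 (umbrellaCube k i j l e m) := by
  intro v _ hv
  exfalso
  rw [hironakaDelta_umbrellaCube hij hil hie hle hm, WithTop.coe_eq_coe] at hv
  exact natCast_ne_three_halves' v.degree hv

end Germ

/-! ## §2 The coordinate centre `(X_i², X_e³, X_j^{m+1}, X_l^{m+1})`: `(2, 3, m+1, m+1) ∈ W` -/

section Centre

variable {i j l e : Fin N} {m : ℕ}

/-- The cocharacter of the coordinate centre `(X_i², X_e³, X_j^{m+1}, X_l^{m+1})`.
[cite: AbramovichTemkinWlodarczyk2024, §5.1 (p. 1575)] -/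
def umbrellaCubeWeights (i j l e : Fin N) (m : ℕ) : Fin N → ℚ := fun x =>
  if x = i then 1 / 2 else if x = j ∨ x = l then (((m + 1 : ℕ) : ℚ))⁻¹ else if x = e then 1 / 3 else 0

/-- Values of the cocharacter (plumbing). [folklore] -/
private theorem umbrellaCubeWeights_i : umbrellaCubeWeights i j l e m i = 1 / 2 := by
  simp [umbrellaCubeWeights]

/-- Values of the cocharacter (plumbing). [folklore] -/
private theorem umbrellaCubeWeights_j (hij : i ≠ j) : umbrellaCubeWeights i j l e m j = (((m + 1 : ℕ) : ℚ))⁻¹ := by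
  simp [umbrellaCubeWeights, hij.symm]

/-- Values of the cocharacter (plumbing). [folklore] -/
private theorem umbrellaCubeWeights_l (hil : i ≠ l) : umbrellaCubeWeights i j l e m l = (((m + 1 : ℕ) : ℚ))⁻¹ := by
  simp [umbrellaCubeWeights, hil.symm]

/-- Values of the cocharacter (plumbing). [folklore] -/
private theorem umbrellaCubeWeights_e (hie : i ≠ e) (hje : j ≠ e) (hle : l ≠ e) :
    umbrellaCubeWeights i j l e m e = 1 / 3 := by
  simp [umbrellaCubeWeights, hie.symm, hje.symm, hle.symm]

/-- Values of the cocharacter (plumbing). [folklore] -/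
private theorem umbrellaCubeWeights_of_ne {x : Fin N} (h1 : x ≠ i) (h2 : x ≠ j) (h3 : x ≠ l) (h4 : x ≠ e) :
    umbrellaCubeWeights i j l e m x = 0 := by
  simp [umbrellaCubeWeights, h1, h2, h3, h4]

/-- `exps` of the cocharacter is `[2, 3, m+1, m+1]` (`m ≥ 2`). (derived here)
[cite: AbramovichTemkinWlodarczyk2024, §5.1 (p. 1575) (invariant (a₁,…,a_k) of the centre)] -/
theorem exps_umbrellaCubeWeights (hij : i ≠ j) (hil : i ≠ l) (hie : i ≠ e) (hjl : j ≠ l) (hje : j ≠ e)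
    (hle : l ≠ e) (hm : 2 ≤ m) :
    exps (umbrellaCubeWeights i j l e m) = [(2 : ℚ), 3, ((m + 1 : ℕ) : ℚ), ((m + 1 : ℕ) : ℚ)] := by
  classical
  have hM0 : (((m + 1 : ℕ) : ℚ)) ≠ 0 := by positivity
  have hfilter : (Finset.univ.filter fun x => umbrellaCubeWeights i j l e m x ≠ 0) = {i, e, j, l} := by
    ext x
    simp only [Finset.mem_filter, Finset.mem_univ, true_and, Finset.mem_insert, Finset.mem_singleton]
    constructor
    · intro hx
      by_contra hne
      push Not at hne
      exact hx (umbrellaCubeWeights_of_ne hne.1 hne.2.2.1 hne.2.2.2 hne.2.1)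
    · rintro (rfl | rfl | rfl | rfl)
      · rw [umbrellaCubeWeights_i]; norm_num
      · rw [umbrellaCubeWeights_e hie hje hle]; norm_num
      · rw [umbrellaCubeWeights_j hij]; exact inv_ne_zero hM0
      · rw [umbrellaCubeWeights_l hil]; exact inv_ne_zero hM0
  have h4 : (({i, e, j, l} : Finset (Fin N)).toList).Perm [i, e, j, l] :=
    (Finset.toList_insert (by simp [hij, hil, hie])).trans
      (List.Perm.cons _ ((Finset.toList_insert (by simp [hje.symm, hle.symm])).trans
        (List.Perm.cons _ ((Finset.toList_insert (by simp [hjl])).trans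
          (List.Perm.of_eq (by rw [Finset.toList_singleton]))))))
  have hperm : (exps (umbrellaCubeWeights i j l e m)).Perm
      [(2 : ℚ), 3, ((m + 1 : ℕ) : ℚ), ((m + 1 : ℕ) : ℚ)] := by
    unfold exps
    refine (List.perm_insertionSort _ _).trans ?_
    rw [hfilter]
    refine (h4.map _).trans (List.Perm.of_eq ?_)
    simp only [List.map_cons, List.map_nil, umbrellaCubeWeights_i, umbrellaCubeWeights_j hij,
      umbrellaCubeWeights_l hil, umbrellaCubeWeights_e hie hje hle, inv_inv, one_div]
  have hsorted : [(2 : ℚ), 3, ((m + 1 : ℕ) : ℚ), ((m + 1 : ℕ) : ℚ)].Pairwise (· ≤ ·) := by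
    have h3 : (3 : ℚ) ≤ ((m + 1 : ℕ) : ℚ) := by
      have : (3 : ℕ) ≤ m + 1 := by omega
      exact_mod_cast this
    have h2 : (2 : ℚ) ≤ ((m + 1 : ℕ) : ℚ) := by linarith
    simp only [List.pairwise_cons, List.mem_cons, List.not_mem_nil, List.Pairwise.nil, forall_eq_or_imp,
      forall_eq, or_false, and_true, IsEmpty.forall_iff, implies_true]
    exact ⟨⟨by norm_num, h2, h2⟩, ⟨h3, h3⟩, le_rfl⟩
  exact hperm.eq_of_sortedLE (exps_sorted _).sortedLE hsorted.sortedLE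

/-- The coordinate centre `(X_i², X_e³, X_j^{m+1}, X_l^{m+1})` is admissible (`Ψ = id`). (derived here)
[cite: AbramovichTemkinWlodarczyk2024, §5.1 (p. 1575) and Rem. 5.2.3 (admissibility via v_J)] -/
theorem isCentreFor_umbrellaCubeWeights (hij : i ≠ j) (hil : i ≠ l) (hie : i ≠ e) (hje : j ≠ e)
    (hle : l ≠ e) :
    IsCentreFor (umbrellaCube k i j l e m) AlgEquiv.refl (umbrellaCubeWeights i j l e m) := by
  have hM0 : (((m + 1 : ℕ) : ℚ)) ≠ 0 := by positivity
  refine ⟨fun x => constantCoeff_X k x, fun x => ?_, fun d hd => ?_⟩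
  · unfold umbrellaCubeWeights
    split_ifs
    · norm_num
    · positivity
    · norm_num
    · exact le_rfl
  · change d ∈ (umbrellaCube k i j l e m).support at hd
    rcases mem_support_umbrellaCube hd with rfl | rfl | rfl
    · rw [monomialValuation, Finsupp.sum_single_index (by simp), umbrellaCubeWeights_i]; norm_num
    · rw [umbExp, monomialValuation, Finsupp.sum_add_index' (by simp) (by intros; simp [add_mul]),
        Finsupp.sum_single_index (by simp), Finsupp.sum_single_index (by simp), umbrellaCubeWeights_j hij,
        umbrellaCubeWeights_l hil]
      rw [Nat.cast_one, one_mul, ← add_one_mul, ← Nat.cast_succ, mul_inv_cancel₀ hM0]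
    · rw [monomialValuation, Finsupp.sum_single_index (by simp), umbrellaCubeWeights_e hie hje hle]
      norm_num

/-- **`(2, 3, m+1, m+1) ∈ W(X_i² + X_j^m X_l + X_e³)`** (`m ≥ 2`). (derived here)
[cite: AbramovichTemkinWlodarczyk2024, §5.1 (p. 1575)] -/
theorem umbrellaCube_inv_mem (hij : i ≠ j) (hil : i ≠ l) (hie : i ≠ e) (hjl : j ≠ l) (hje : j ≠ e)
    (hle : l ≠ e) (hm : 2 ≤ m) :
    [(2 : ℚ), 3, ((m + 1 : ℕ) : ℚ), ((m + 1 : ℕ) : ℚ)] ∈ admissibleInvariants (umbrellaCube k i j l e m) := by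
  rw [← exps_umbrellaCubeWeights hij hil hie hjl hje hle hm]
  exact exps_mem_admissibleInvariants (isCentreFor_umbrellaCubeWeights hij hil hie hje hle)

end Centre

/-! ## §3 The first face: nothing in `W` is above `(2, 3)` -/

section FirstFace

variable {i j l e : Fin N} {m : ℕ}

/-- Every non-zero weight contributes its inverse to `exps` (plumbing). [folklore] -/
private theorem inv_mem_exps_of_ne_zero₆ {γ : Fin N → ℚ} {x : Fin N} (hx : γ x ≠ 0) : (γ x)⁻¹ ∈ exps γ := by
  classical
  unfold exps
  rw [List.mem_insertionSort, List.mem_map]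
  exact ⟨x, Finset.mem_toList.2 (Finset.mem_filter.2 ⟨Finset.mem_univ _, hx⟩), rfl⟩

/-- Heads of sorted lists (plumbing). [folklore] -/
private theorem le_of_mem_of_pairwise₆ {a x : ℚ} {es : List ℚ} (hs : (a :: es).Pairwise (· ≤ ·))
    (hx : x ∈ a :: es) : a ≤ x := by
  rcases List.mem_cons.1 hx with rfl | hx
  · exact le_rfl
  · exact (List.pairwise_cons.1 hs).1 x hx

/-- **First face: nothing in `W(X_i² + X_j^m X_l + X_e³)` is above `(2, 3)`** (`m ≥ 2`, `i, j, l, e` distinct,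
spectators allowed, EVERY characteristic, ALL polynomial coordinate changes): for `b ∈ W(f)`, `b₁ ≤ 2`, and
`b₁ = 2` forces a second entry `≤ 3` (so `b ≠ [2]`).  (derived here, from the vertex theorems with `y = X_i`,
`ν = 2`, `δ = 3/2 ∉ ℕ`) [cite: AbramovichTemkinWlodarczyk2024, Thm. 5.3.1 (2) (p. 1578) (inv = max over
admissible centres)] [cite: CossartJannsenSaito2020, Thm. 8.16 (p. 121) (δ-prepared polyhedron computes the
invariant), Thm. 8.22 (a) (p. 124)] -/
theorem not_lt_of_mem_admissibleInvariants_umbrellaCube (hij : i ≠ j) (hil : i ≠ l) (hie : i ≠ e)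
    (hjl : j ≠ l) (hle : l ≠ e) (hm : 2 ≤ m) {b : List ℚ} (hb : b ∈ admissibleInvariants (umbrellaCube k i j l e m)) :
    ¬ ATW.TruncLex.lt [(2 : ℚ), 3] b := by
  classical
  set f := umbrellaCube k i j l e m with hf
  have hpδ : ((2 : ℕ) : ℚ) * ((3 : ℚ) / 2) = 3 := by norm_num
  have hord : monomialOrd (fun _ => 1) f = 2 := monomialOrd_umbrellaCube hil hie hjl (by omega)
  have hin : homogeneousComponent 2 f = X i ^ 2 := homogeneousComponent_umbrellaCube (by omega)
  have hτ : ({i} : Finset (Fin N)).card = hironakaTau k {homogeneousComponent 2 f} := by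
    rw [hin, hironakaTau_X_pow i two_ne_zero, Finset.card_singleton]
  have hFS : ∀ d ∈ (homogeneousComponent 2 f).support, ∀ x ∉ ({i} : Finset (Fin N)), d x = 0 := by
    intro d hd x hx
    rw [hin, X_pow_eq_monomial] at hd
    have hd' := Finset.mem_singleton.1 (support_monomial_subset hd)
    rw [Finset.mem_singleton] at hx
    rw [hd', Finsupp.single_apply, if_neg (Ne.symm hx)]
  have hδ : hironakaDelta {i} 2 f = (((3 : ℚ) / 2 : ℚ) : WithTop ℚ) :=
    hironakaDelta_umbrellaCube hij hil hie hle hm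
  have hprep : IsDeltaPrepared {i} 2 f := isDeltaPrepared_umbrellaCube hij hil hie hle hm
  obtain ⟨Ψ, γ, h, rfl⟩ := hb
  have hsorted := exps_sorted γ
  by_cases hle' : ∀ x, γ x ≤ ((2 : ℕ) : ℚ)⁻¹
  · obtain ⟨es, hes⟩ : ∃ es, exps γ = ((2 : ℕ) : ℚ) :: es := by
      obtain ⟨t, ht⟩ := replicate_prefix_of_forall_le hord h hle'
      rw [← hτ, Finset.card_singleton, List.replicate_one] at ht
      exact ⟨t, ht.symm⟩
    have hcount := succ_card_le_countP_exps_of_isDeltaPrepared hord hτ hFS hprep hδ h hle'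
    rw [Finset.card_singleton, hpδ, hes, List.countP_cons_of_pos (by norm_num)] at hcount
    rw [hes] at hsorted
    obtain ⟨e₂, es', rfl⟩ : ∃ e₂ es', es = e₂ :: es' := by
      cases es with
      | nil => simp at hcount
      | cons e₂ es' => exact ⟨e₂, es', rfl⟩
    have hs₂ : (e₂ :: es').Pairwise (· ≤ ·) := (List.pairwise_cons.1 hsorted).2
    have he₂ : e₂ ≤ 3 := by
      obtain ⟨x, hx, hxθ⟩ := List.countP_pos_iff.1 (show 0 < (e₂ :: es').countP fun x => decide (x ≤ 3) by omega)
      exact (le_of_mem_of_pairwise₆ hs₂ hx).trans (by simpa using hxθ)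
    rw [hes, Nat.cast_two, ATW.TruncLex.cons_lt_cons, ATW.TruncLex.cons_lt_cons]
    rintro (h1 | ⟨-, h2 | ⟨-, h3⟩⟩)
    · exact lt_irrefl _ h1
    · exact not_lt.2 he₂ h2
    · exact ATW.TruncLex.not_nil_lt _ h3
  · push Not at hle'
    obtain ⟨x, hx⟩ := hle'
    rw [Nat.cast_two] at hx
    have hγx : γ x ≠ 0 := (lt_trans (by norm_num) hx).ne'
    have hlt : (γ x)⁻¹ < 2 := inv_lt_of_inv_lt₀ (by norm_num) hx
    have hmem := inv_mem_exps_of_ne_zero₆ hγx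
    obtain ⟨a, es, hes⟩ : ∃ a es, exps γ = a :: es := by
      cases hq' : exps γ with
      | nil => rw [hq'] at hmem; simp at hmem
      | cons a es => exact ⟨a, es, rfl⟩
    rw [hes] at hmem hsorted ⊢
    have ha : a < 2 := (le_of_mem_of_pairwise₆ hsorted hmem).trans_lt hlt
    rw [ATW.TruncLex.cons_lt_cons]
    rintro (h1 | ⟨h2, -⟩)
    · exact lt_asymm ha h1
    · exact ha.ne' h2

end FirstFace

/-! ## §4 Peeling the invariant: weights from `exps` -/

section Peel

/-- **Peeling the smallest exponent**: if `exps γ = x :: t` (`γ ≥ 0` not needed) then some variable `a` has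
`γ a = x⁻¹ ≠ 0`, and forgetting it leaves the invariant `t`. (derived here)
[cite: AbramovichTemkinWlodarczyk2024, §5.1 (p. 1575) (the invariant lists the exponents `1/γ_i` increasingly)] -/
theorem exists_update_of_exps_eq_cons {γ : Fin N → ℚ} {x : ℚ} {t : List ℚ} (h : exps γ = x :: t) :
    ∃ a : Fin N, γ a ≠ 0 ∧ γ a = x⁻¹ ∧ exps (Function.update γ a 0) = t := by
  classical
  set F : Finset (Fin N) := Finset.univ.filter fun i => γ i ≠ 0 with hF
  have hmem : x ∈ exps γ := by rw [h]; exact List.mem_cons_self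
  have hmem' := hmem
  unfold exps at hmem'
  rw [List.mem_insertionSort, List.mem_map] at hmem'
  obtain ⟨a, ha, hax⟩ := hmem'
  have haF : a ∈ F := Finset.mem_toList.1 ha
  have hγa : γ a ≠ 0 := (Finset.mem_filter.1 haF).2
  refine ⟨a, hγa, by rw [← hax, inv_inv], ?_⟩
  -- the filtered set of the updated weights is `F.erase a`
  have hF' : (Finset.univ.filter fun i => Function.update γ a 0 i ≠ 0) = F.erase a := by
    ext y
    simp only [Finset.mem_filter, Finset.mem_univ, true_and, Finset.mem_erase, hF]
    by_cases hy : y = a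
    · subst hy; simp
    · rw [Function.update_of_ne hy]; exact ⟨fun h' => ⟨hy, h'⟩, fun h' => h'.2⟩
  have hmap : ∀ y ∈ (F.erase a).toList, (Function.update γ a 0 y)⁻¹ = (γ y)⁻¹ := by
    intro y hy
    rw [Function.update_of_ne (Finset.mem_erase.1 (Finset.mem_toList.1 hy)).1]
  set L' := (F.erase a).toList.map fun i => (γ i)⁻¹ with hL'
  have hexps' : exps (Function.update γ a 0) = L'.insertionSort (· ≤ ·) := by
    unfold exps
    rw [hF', List.map_congr_left hmap]
  -- `x :: L'` is a permutation of the defining list of `exps γ`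
  have hpermF : F.toList.Perm (a :: (F.erase a).toList) := by
    have : F = insert a (F.erase a) := (Finset.insert_erase haF).symm
    rw [this]
    simpa using Finset.toList_insert (Finset.notMem_erase a F)
  have hperm : (x :: t).Perm (x :: L'.insertionSort (· ≤ ·)) := by
    rw [← h]
    unfold exps
    refine (List.perm_insertionSort _ _).trans ?_
    refine ((hpermF.map fun i => (γ i)⁻¹).trans ?_)
    rw [List.map_cons, hax]
    exact List.Perm.cons _ (List.perm_insertionSort _ _).symm
  have hsorted₁ : (x :: t).Pairwise (· ≤ ·) := h ▸ exps_sorted γ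
  have hsorted₂ : (x :: L'.insertionSort (· ≤ ·)).Pairwise (· ≤ ·) := by
    rw [List.pairwise_cons]
    refine ⟨fun y hy => ?_, List.pairwise_insertionSort _ _⟩
    have hy' : y ∈ x :: t := hperm.symm.subset (List.mem_cons_of_mem _ hy)
    rcases List.mem_cons.1 hy' with rfl | hy''
    · exact le_rfl
    · exact (List.pairwise_cons.1 hsorted₁).1 y hy''
  have := hperm.eq_of_sortedLE hsorted₁.sortedLE hsorted₂.sortedLE
  rw [hexps']
  exact (List.cons.inj this).2.symm

/-- **Bounding the remaining weights**: if `exps γ = t` and every entry of `t` is `≥ c > 0`, then every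
non-negative weight is `≤ 1/c`. (derived here) [cite: AbramovichTemkinWlodarczyk2024, §5.1 (p. 1575)] -/
theorem le_inv_of_exps_eq {γ : Fin N → ℚ} {t : List ℚ} (h : exps γ = t) {c : ℚ} (hc : 0 < c)
    (ht : ∀ y ∈ t, c ≤ y) (hγ : ∀ x, 0 ≤ γ x) (x : Fin N) : γ x ≤ 1 / c := by
  by_cases hx : γ x = 0
  · rw [hx]; positivity
  have hpos : 0 < γ x := lt_of_le_of_ne (hγ x) (Ne.symm hx)
  have hmem := inv_mem_exps_of_ne_zero₆ hx
  rw [h] at hmem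
  have := ht _ hmem
  rw [← inv_inv (γ x), ← one_div]
  exact one_div_le_one_div_of_le hc this

/-- Non-negativity survives forgetting a variable (plumbing). [folklore] -/
private theorem update_nonneg {γ : Fin N → ℚ} (hγ : ∀ x, 0 ≤ γ x) (a : Fin N) (x : Fin N) :
    0 ≤ Function.update γ a 0 x := by
  by_cases hx : x = a
  · subst hx; simp
  · rw [Function.update_of_ne hx]; exact hγ x

end Peel

/-! ## §5 Taylor expansion along a vector field, with values in a `k`-algebra -/

section FieldTaylorA

variable {R : Type*} [CommRing R] [Algebra k R]
variable (ρ : MvPolynomial (Fin N) k →ₐ[k] R) (ξ : Fin N → MvPolynomial (Fin N) k)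

/-- **Taylor map to order `ε` along the vector field `ξ = Σ ξ_m ∂_m`, composed with a restriction `ρ`**
with values in any `k`-algebra `R`: `X_m ↦ ρ(X_m) + ε·ρ(ξ_m)` (construction; generalises `fieldTaylor`).
[cite: CossartJannsenSaito2020, Def. 1.26 (normal cone), §2.2 (p. 21)] -/
noncomputable def fieldTaylorₐ : MvPolynomial (Fin N) k →ₐ[k] Polynomial R :=
  aeval fun x => Polynomial.C (ρ (X x)) + Polynomial.X * Polynomial.C (ρ (ξ x))

/-- Value on a variable (plumbing). [cite: CossartJannsenSaito2020, Def. 1.26] -/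
theorem fieldTaylorₐ_X (x : Fin N) :
    fieldTaylorₐ ρ ξ (X x) = Polynomial.C (ρ (X x)) + Polynomial.X * Polynomial.C (ρ (ξ x)) := by
  rw [fieldTaylorₐ, aeval_X]

/-- **Order `0`**: the `ε⁰`-coefficient is the restriction `ρ`. (derived here)
[cite: CossartJannsenSaito2020, Def. 1.26] -/
theorem coeff_zero_fieldTaylorₐ (P : MvPolynomial (Fin N) k) : (fieldTaylorₐ ρ ξ P).coeff 0 = ρ P := by
  induction P using MvPolynomial.induction_on with
  | C a => rw [fieldTaylorₐ, algHom_C, Polynomial.algebraMap_apply, Polynomial.coeff_C_zero, algHom_C]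
  | add p q hp hq => rw [map_add, Polynomial.coeff_add, hp, hq, map_add]
  | mul_X p m hp =>
    rw [map_mul, fieldTaylorₐ_X, Polynomial.mul_coeff_zero, hp, Polynomial.coeff_add, Polynomial.coeff_C_zero,
      Polynomial.mul_coeff_zero, Polynomial.coeff_X_zero, zero_mul, add_zero, map_mul]

/-- **Order `1`**: the `ε¹`-coefficient is the restriction of the derivative `ξ(P) = Σ_m ξ_m ∂_m P`.
(derived here) [cite: CossartJannsenSaito2020, Def. 1.26; AbramovichTemkinWlodarczyk2024, Lemma 5.2.10
(p. 1577)] -/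
theorem coeff_one_fieldTaylorₐ (P : MvPolynomial (Fin N) k) :
    (fieldTaylorₐ ρ ξ P).coeff 1 = ρ (∑ m, ξ m * pderiv m P) := by
  classical
  induction P using MvPolynomial.induction_on with
  | C a =>
    rw [fieldTaylorₐ, algHom_C, Polynomial.algebraMap_apply, Polynomial.coeff_C, if_neg one_ne_zero]
    simp only [pderiv_C, mul_zero, Finset.sum_const_zero, map_zero]
  | add p q hp hq =>
    rw [map_add, Polynomial.coeff_add, hp, hq, ← map_add, ← Finset.sum_add_distrib]
    congr 1
    exact Finset.sum_congr rfl fun m _ => by rw [map_add, mul_add]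
  | mul_X p m hp =>
    have h0 := coeff_zero_fieldTaylorₐ ρ ξ p
    have e1 : (fieldTaylorₐ ρ ξ p * Polynomial.X).coeff 1 = (fieldTaylorₐ ρ ξ p).coeff 0 := by
      simp
    rw [map_mul, fieldTaylorₐ_X, mul_add, Polynomial.coeff_add, Polynomial.coeff_mul_C, hp, ← mul_assoc,
      Polynomial.coeff_mul_C, e1, h0]
    have hsum : ∑ m', ξ m' * pderiv m' (p * X m) = X m * (∑ m', ξ m' * pderiv m' p) + ξ m * p := by
      simp only [Derivation.leibniz, pderiv_X, smul_eq_mul, mul_add, Finset.sum_add_distrib]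
      rw [add_comm]
      congr 1
      · rw [Finset.mul_sum]
        exact Finset.sum_congr rfl fun m' _ => by ring
      · rw [Finset.sum_eq_single m]
        · rw [Pi.single_eq_same, mul_one]
        · intro m' _ hm'
          rw [Pi.single_eq_of_ne' hm', mul_zero, mul_zero]
        · intro h; exact absurd (Finset.mem_univ m) h
    rw [hsum, map_add, map_mul, map_mul]
    ring

end FieldTaylorA

/-! ## §6 Slice orders: `ε^j`-coefficients of large weighted order -/

section SliceOrd

variable {σ : Type*}

/-- `SliceOrd w α s P`: the `ε^j`-coefficient of `P ∈ k[X][ε]` has `w`-order `≥ s - jα` for every `j`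
(the order filtration by `ε ↦ α`, `X^d ↦ weight_w d`). (construction)
[cite: AbramovichTemkinWlodarczyk2024, §2.4 and Lemma 5.2.6 (p. 1577) (v_J of products and powers)] -/
def SliceOrd (w : σ → ℕ) (α s : ℕ) (P : Polynomial (MvPolynomial σ k)) : Prop :=
  ∀ j : ℕ, ((s - j * α : ℕ) : ℕ∞) ≤ monomialOrd w (P.coeff j)

variable {w : σ → ℕ} {α : ℕ}

/-- A lower bound for the order of a finite sum (plumbing). [folklore] -/
private theorem le_monomialOrd_sum {ι : Type*} (S : Finset ι) (F : ι → MvPolynomial σ k) {n : ℕ∞}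
    (h : ∀ x ∈ S, n ≤ monomialOrd w (F x)) : n ≤ monomialOrd w (∑ x ∈ S, F x) := by
  classical
  induction S using Finset.induction_on with
  | empty => rw [Finset.sum_empty, monomialOrd_zero]; exact le_top
  | insert a S ha ih =>
    rw [Finset.sum_insert ha]
    exact (le_min (h a (Finset.mem_insert_self a S)) (ih fun x hx => h x (Finset.mem_insert_of_mem hx))).trans
      (min_monomialOrd_le_add w _ _)

/-- Monotonicity in the bound. [cite: AbramovichTemkinWlodarczyk2024, Lemma 5.2.6 (p. 1577)] -/
theorem SliceOrd.mono {s t : ℕ} {P : Polynomial (MvPolynomial σ k)} (h : SliceOrd w α s P) (hts : t ≤ s) :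
    SliceOrd w α t P := fun j =>
  le_trans (by exact_mod_cast Nat.sub_le_sub_right hts _) (h j)

/-- The trivial bound. [cite: AbramovichTemkinWlodarczyk2024, Lemma 5.2.6 (p. 1577)] -/
theorem SliceOrd.zero_left (P : Polynomial (MvPolynomial σ k)) : SliceOrd w α 0 P := fun j => by
  rw [Nat.zero_sub, Nat.cast_zero]; exact zero_le

/-- Sums. [cite: AbramovichTemkinWlodarczyk2024, Lemma 5.2.6 (p. 1577)] -/
theorem SliceOrd.add {s : ℕ} {P Q : Polynomial (MvPolynomial σ k)} (hP : SliceOrd w α s P)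
    (hQ : SliceOrd w α s Q) : SliceOrd w α s (P + Q) := fun j => by
  rw [Polynomial.coeff_add]
  exact (le_min (hP j) (hQ j)).trans (min_monomialOrd_le_add w _ _)

/-- Finite sums. [cite: AbramovichTemkinWlodarczyk2024, Lemma 5.2.6 (p. 1577)] -/
theorem SliceOrd.sum {ι : Type*} {s : ℕ} (S : Finset ι) {F : ι → Polynomial (MvPolynomial σ k)}
    (h : ∀ x ∈ S, SliceOrd w α s (F x)) : SliceOrd w α s (∑ x ∈ S, F x) := by
  classical
  induction S using Finset.induction_on with
  | empty => rw [Finset.sum_empty]; exact fun j => by rw [Polynomial.coeff_zero, monomialOrd_zero]; exact le_top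
  | insert a S ha ih =>
    rw [Finset.sum_insert ha]
    exact (h a (Finset.mem_insert_self a S)).add (ih fun x hx => h x (Finset.mem_insert_of_mem hx))

/-- Products. [cite: AbramovichTemkinWlodarczyk2024, Lemma 5.2.6 (p. 1577) (v_J(fg) ≥ v_J f + v_J g)] -/
theorem SliceOrd.mul {s t : ℕ} {P Q : Polynomial (MvPolynomial σ k)} (hP : SliceOrd w α s P)
    (hQ : SliceOrd w α t Q) : SliceOrd w α (s + t) (P * Q) := by
  classical
  intro j
  rw [Polynomial.coeff_mul]
  refine le_monomialOrd_sum _ _ fun x hx => ?_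
  have hx' := Finset.mem_antidiagonal.1 hx
  have hle : ((s + t - j * α : ℕ) : ℕ∞) ≤ ((s - x.1 * α : ℕ) : ℕ∞) + ((t - x.2 * α : ℕ) : ℕ∞) := by
    rw [← Nat.cast_add, Nat.cast_le, ← hx', add_mul]
    omega
  exact hle.trans ((add_le_add (hP x.1) (hQ x.2)).trans (add_monomialOrd_le_mul w _ _))

/-- Powers. [cite: AbramovichTemkinWlodarczyk2024, Lemma 5.2.6 (p. 1577)] -/
theorem SliceOrd.pow {s : ℕ} {P : Polynomial (MvPolynomial σ k)} (hP : SliceOrd w α s P) (n : ℕ) :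
    SliceOrd w α (n * s) (P ^ n) := by
  induction n with
  | zero => rw [Nat.zero_mul, pow_zero]; exact SliceOrd.zero_left _
  | succ n ih => rw [pow_succ, Nat.succ_mul]; exact ih.mul hP

/-- Finite products. [cite: AbramovichTemkinWlodarczyk2024, Lemma 5.2.6 (p. 1577)] -/
theorem SliceOrd.prod {ι : Type*} (S : Finset ι) {a : ι → ℕ} {F : ι → Polynomial (MvPolynomial σ k)}
    (h : ∀ x ∈ S, SliceOrd w α (a x) (F x)) : SliceOrd w α (∑ x ∈ S, a x) (∏ x ∈ S, F x) := by
  classical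
  induction S using Finset.induction_on with
  | empty => rw [Finset.sum_empty, Finset.prod_empty]; exact SliceOrd.zero_left _
  | insert b S hb ih =>
    rw [Finset.sum_insert hb, Finset.prod_insert hb]
    exact (h b (Finset.mem_insert_self b S)).mul (ih fun x hx => h x (Finset.mem_insert_of_mem hx))

/-- Constants do not lower slice orders. [cite: AbramovichTemkinWlodarczyk2024, Lemma 5.2.6 (p. 1577)] -/
theorem SliceOrd.C_mul {s : ℕ} {P : Polynomial (MvPolynomial σ k)} (hP : SliceOrd w α s P)
    (r : MvPolynomial σ k) : SliceOrd w α s (Polynomial.C r * P) := fun j => by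
  rw [Polynomial.coeff_C_mul]
  exact (hP j).trans (le_add_self.trans (add_monomialOrd_le_mul w r _))

/-- A generator bound from the first two slices, when `s ≤ 2α`. (derived here)
[cite: AbramovichTemkinWlodarczyk2024, Lemma 5.2.6 (p. 1577)] -/
theorem sliceOrd_of_coeff {s : ℕ} {P : Polynomial (MvPolynomial σ k)} (h0 : (s : ℕ∞) ≤ monomialOrd w (P.coeff 0))
    (h1 : ((s - α : ℕ) : ℕ∞) ≤ monomialOrd w (P.coeff 1)) (h2 : s ≤ 2 * α) : SliceOrd w α s P := by
  intro j
  match j with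
  | 0 => rwa [Nat.zero_mul, Nat.sub_zero]
  | 1 => rwa [Nat.one_mul]
  | j + 2 =>
    rw [Nat.sub_eq_zero_of_le (h2.trans (Nat.mul_le_mul_right α (by omega))), Nat.cast_zero]
    exact zero_le

/-- **Transfer of admissibility through generators**: if `φ : k[X] → k[X][ε]` is a `k`-algebra map with
`SliceOrd w α (qs x) (φ X_x)` for every variable, then `φ F` has slice order `≥ s` whenever every monomial
of `F` has `qs`-weight `≥ s`. (derived here) [cite: AbramovichTemkinWlodarczyk2024, Lemma 5.2.6 and
Cor. 5.2.9 (p. 1577) (admissibility is generated by monomial bounds)] -/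
theorem SliceOrd.map {τ : Type*} {φ : MvPolynomial τ k →ₐ[k] Polynomial (MvPolynomial σ k)} (qs : τ → ℕ)
    (hφ : ∀ x, SliceOrd w α (qs x) (φ (X x))) {F : MvPolynomial τ k} {s : ℕ}
    (hF : ∀ dd ∈ F.support, s ≤ Finsupp.weight qs dd) : SliceOrd w α s (φ F) := by
  classical
  rw [F.as_sum, map_sum]
  refine SliceOrd.sum _ fun dd hdd => ?_
  rw [monomial_eq, map_mul, algHom_C, Polynomial.algebraMap_apply, algebraMap_eq, map_finsuppProd]
  simp only [map_pow]
  refine SliceOrd.C_mul (SliceOrd.mono ?_ (hF dd hdd)) _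
  have hw : Finsupp.weight qs dd = ∑ x ∈ dd.support, dd x * qs x := by
    rw [Finsupp.weight_apply, Finsupp.sum]; rfl
  rw [hw]
  exact SliceOrd.prod _ fun x _ => (hφ x).pow (dd x)

end SliceOrd

/-! ## §7 Killing variables, linear forms, constant coefficients -/

section Kill

/-- The substitution `X_x ↦ 0` (`x ∈ H`), `X_x ↦ X_x` (`x ∉ H`): restriction to a coordinate subspace
(construction). [cite: CossartJannsenSaito2020, Def. 1.26 (restriction to the directrix / a subspace)] -/
noncomputable def killHom (H : Finset (Fin N)) : MvPolynomial (Fin N) k →ₐ[k] MvPolynomial (Fin N) k :=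
  aeval fun x => if x ∈ H then 0 else X x

variable {H : Finset (Fin N)}

/-- Value on a killed variable (plumbing). [cite: CossartJannsenSaito2020, Def. 1.26] -/
theorem killHom_X_of_mem {x : Fin N} (hx : x ∈ H) : killHom (k := k) H (X x) = 0 := by
  rw [killHom, aeval_X, if_pos hx]

/-- Value on a surviving variable (plumbing). [cite: CossartJannsenSaito2020, Def. 1.26] -/
theorem killHom_X_of_not_mem {x : Fin N} (hx : x ∉ H) : killHom (k := k) H (X x) = X x := by
  rw [killHom, aeval_X, if_neg hx]

/-- Value on a monomial (plumbing). [folklore] -/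
private theorem killHom_monomial (e : Fin N →₀ ℕ) (c : k) :
    killHom H (monomial e c) = if ∃ x ∈ H, e x ≠ 0 then 0 else monomial e c := by
  classical
  rw [killHom, aeval_monomial, algebraMap_eq]
  split_ifs with h
  · obtain ⟨x, hxH, hex⟩ := h
    have hx : x ∈ e.support := Finsupp.mem_support_iff.2 hex
    rw [Finsupp.prod, ← Finset.mul_prod_erase _ _ hx, if_pos hxH, zero_pow hex, zero_mul, mul_zero]
  · push Not at h
    rw [monomial_eq]
    congr 1
    exact Finset.prod_congr rfl fun x hx => by
      beta_reduce
      rw [if_neg (fun hxH => (Finsupp.mem_support_iff.1 hx) (h x hxH))]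

/-- **Coefficients of monomials avoiding `H` are unchanged by killing `H`.** (derived here)
[cite: CossartJannsenSaito2020, Def. 1.26] -/
theorem coeff_killHom_of_forall_eq_zero {d : Fin N →₀ ℕ} (hd : ∀ x ∈ H, d x = 0) (P : MvPolynomial (Fin N) k) :
    coeff d (killHom H P) = coeff d P := by
  classical
  induction P using MvPolynomial.induction_on' with
  | monomial e c =>
    rw [killHom_monomial]
    split_ifs with h
    · obtain ⟨x, hxH, hex⟩ := h
      rw [coeff_zero, coeff_monomial, if_neg]
      rintro rfl
      exact hex (hd x hxH)
    · rfl
  | add p q hp hq => rw [map_add, coeff_add, coeff_add, hp, hq]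

/-- **Monomials involving a killed variable disappear.** (derived here) [cite: CossartJannsenSaito2020, Def. 1.26] -/
theorem coeff_killHom_of_ne_zero {d : Fin N →₀ ℕ} {x : Fin N} (hx : x ∈ H) (hd : d x ≠ 0)
    (P : MvPolynomial (Fin N) k) : coeff d (killHom H P) = 0 := by
  classical
  induction P using MvPolynomial.induction_on' with
  | monomial e c =>
    rw [killHom_monomial]
    split_ifs with h
    · exact coeff_zero _
    · push Not at h
      rw [coeff_monomial, if_neg]
      rintro rfl
      exact hd (h x hx)
  | add p q hp hq => rw [map_add, coeff_add, hp, hq, add_zero]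

/-- Killing variables preserves constant coefficients. (derived here) [cite: CossartJannsenSaito2020, Def. 1.26] -/
theorem constantCoeff_killHom (P : MvPolynomial (Fin N) k) : constantCoeff (killHom H P) = constantCoeff P := by
  have h := coeff_killHom_of_forall_eq_zero (H := H) (d := 0) (fun _ _ => rfl) P
  rwa [← constantCoeff_eq] at h

/-- An automorphism fixing the origin preserves constant coefficients (plumbing). [folklore] -/
private theorem constantCoeff_map_of_fix' (Φ : MvPolynomial (Fin N) k ≃ₐ[k] MvPolynomial (Fin N) k)
    (hΦ : ∀ m, constantCoeff (Φ (X m)) = 0) (P : MvPolynomial (Fin N) k) :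
    constantCoeff (Φ P) = constantCoeff P := by
  induction P using MvPolynomial.induction_on with
  | C a => rw [show Φ (C a) = C a from Φ.commutes a]
  | add p q hp hq => rw [map_add, map_add, hp, hq, map_add]
  | mul_X p m hp => rw [map_mul, map_mul, hp, hΦ, map_mul, constantCoeff_X]

/-- The constant coefficient of a partial derivative is the linear coefficient (plumbing). [folklore] -/
private theorem constantCoeff_pderiv' (y : Fin N) (P : MvPolynomial (Fin N) k) :
    constantCoeff (pderiv y P) = coeff (Finsupp.single y 1) P := by
  classical
  induction P using MvPolynomial.induction_on with
  | C a =>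
    rw [pderiv_C, map_zero, coeff_C, if_neg (Finsupp.single_ne_zero.2 one_ne_zero).symm]
  | add p q hp hq => rw [map_add, map_add, hp, hq, coeff_add]
  | mul_X p m hp =>
    rw [Derivation.leibniz, smul_eq_mul, smul_eq_mul, map_add, map_mul, map_mul, constantCoeff_X, zero_mul,
      add_zero, pderiv_X, coeff_mul_X']
    by_cases hmy : m = y
    · subst hmy
      rw [Pi.single_eq_same, map_one, mul_one, if_pos (by simp), tsub_self, ← constantCoeff_eq]
    · have hns : m ∉ (Finsupp.single y 1).support := fun h =>
        hmy ((Finsupp.mem_support_single _ _ _).1 h).1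
      rw [Pi.single_eq_of_ne hmy, map_zero, mul_zero, if_neg hns]

/-- `(p ∂_i + q ∂_x)(P) = p ∂_i P + q ∂_x P` (plumbing). [folklore] -/
private theorem sum_pairField_mul' {i x : Fin N} (hix : i ≠ x) (p q : MvPolynomial (Fin N) k)
    (D : Fin N → MvPolynomial (Fin N) k) :
    ∑ m, pairField i x p q m * D m = p * D i + q * D x := by
  classical
  have : ∀ m, pairField i x p q m * D m = (if m = i then p * D i else 0) + (if m = x then q * D x else 0) := by
    intro m
    unfold pairField
    by_cases h1 : m = i
    · subst h1; rw [if_pos rfl, if_pos rfl, if_neg hix, add_zero]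
    · rw [if_neg h1, if_neg h1, zero_add]
      by_cases h2 : m = x
      · subst h2; rw [if_pos rfl, if_pos rfl]
      · rw [if_neg h2, if_neg h2, zero_mul]
  rw [Finset.sum_congr rfl fun m _ => this m, Finset.sum_add_distrib, Finset.sum_ite_eq' Finset.univ i,
    Finset.sum_ite_eq' Finset.univ x, if_pos (Finset.mem_univ _), if_pos (Finset.mem_univ _)]

/-- `Σ_m δ_{m,i} D_m = D_i` (plumbing). [folklore] -/
private theorem sum_single_mul' (i : Fin N) (D : Fin N → MvPolynomial (Fin N) k) :
    ∑ m, (Pi.single i 1 : Fin N → MvPolynomial (Fin N) k) m * D m = D i := by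
  classical
  rw [Finset.sum_eq_single i (fun m _ hm => by rw [Pi.single_eq_of_ne hm, zero_mul])
    (fun h => absurd (Finset.mem_univ i) h), Pi.single_eq_same, one_mul]

/-- The linear form with coefficient vector `α` (construction, ours; plumbing for the degree-one
homogeneous components of [cite: CossartJannsenSaito2020, §2.2 (p. 21) (initial forms, directrix)]). -/
noncomputable def linForm (α : Fin N → k) : MvPolynomial (Fin N) k := ∑ x, C (α x) * X x

/-- Coefficients of a linear form (plumbing). [folklore] -/
private theorem coeff_single_linForm (α : Fin N → k) (y : Fin N) :
    coeff (Finsupp.single y 1) (linForm α) = α y := by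
  classical
  rw [linForm, coeff_sum, Finset.sum_eq_single y]
  · rw [coeff_C_mul, coeff_X, if_pos rfl, mul_one]
  · intro x _ hxy
    rw [coeff_C_mul, coeff_X, if_neg (fun h => hxy (Finsupp.single_left_injective one_ne_zero h)), mul_zero]
  · intro h; exact absurd (Finset.mem_univ y) h

/-- A linear form vanishes iff its coefficients do (plumbing). [folklore] -/
private theorem linForm_eq_zero_iff (α : Fin N → k) : linForm α = 0 ↔ ∀ x, α x = 0 := by
  refine ⟨fun h x => ?_, fun h => ?_⟩
  · rw [← coeff_single_linForm α x, h, coeff_zero]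
  · rw [linForm]
    exact Finset.sum_eq_zero fun x _ => by rw [h x, C_0, zero_mul]

/-- Killing `X_d` in a linear form (plumbing). [folklore] -/
private theorem killHom_linForm (α : Fin N → k) (d : Fin N) :
    killHom {d} (linForm α) = linForm (Function.update α d 0) := by
  classical
  rw [linForm, linForm, map_sum]
  refine Finset.sum_congr rfl fun x _ => ?_
  rw [map_mul, algHom_C, algebraMap_eq]
  by_cases hx : x = d
  · subst hx
    rw [killHom_X_of_mem (Finset.mem_singleton_self _), Function.update_self, mul_zero, C_0, zero_mul]
  · rw [killHom_X_of_not_mem (by rwa [Finset.mem_singleton]), Function.update_of_ne hx]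

/-- A linear form supported on one variable (plumbing). [folklore] -/
private theorem linForm_eq_C_mul_X {α : Fin N → k} {d : Fin N} (h : ∀ x, x ≠ d → α x = 0) :
    linForm α = C (α d) * X d := by
  classical
  rw [linForm, Finset.sum_eq_single d (fun x _ hx => by rw [h x hx, C_0, zero_mul])
    (fun h' => absurd (Finset.mem_univ d) h')]

/-- **The linear part is the linear form of the linear coefficients.** (derived here)
[cite: AbramovichTemkinWlodarczyk2024, proof of Thm. 5.3.1 (2)–(3) (p. 1578), §3.4 (p. 1570)] -/
theorem homogeneousComponent_one_eq_linForm (P : MvPolynomial (Fin N) k) :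
    homogeneousComponent 1 P = linForm fun x => coeff (Finsupp.single x 1) P := by
  classical
  have h := weightedHomogeneousComponent_one_weightedHomogeneousComponent (fun _ : Fin N => (1 : ℕ)) 1 P
  rw [Finset.filter_true_of_mem (fun _ _ => rfl)] at h
  change homogeneousComponent 1 (homogeneousComponent 1 P) = _ at h
  rwa [homogeneousComponent_of_mem (homogeneousComponent_mem 1 P), if_pos rfl] at h

/-- **Trichotomy for `A^m · B = κ X_d^{m+1}` with linear forms `A, B`** (`m ≥ 1`): either both forms are
multiples of `X_d`, or one of them vanishes. (derived here; elementary unique factorisation)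
[cite: AbramovichTemkinWlodarczyk2024, proof of Thm. 5.3.1 (2)–(3) (p. 1578)] -/
theorem linForm_trichotomy {α β : Fin N → k} {d : Fin N} {m : ℕ} (hm : 1 ≤ m) {c : k}
    (h : linForm α ^ m * linForm β = C c * X d ^ (m + 1)) :
    (∀ x, x ≠ d → α x = 0 ∧ β x = 0) ∨ (∀ x, α x = 0) ∨ (∀ x, β x = 0) := by
  classical
  have hXd : killHom (k := k) {d} (X d) = 0 := killHom_X_of_mem (Finset.mem_singleton_self _)
  have hC : ∀ u : k, killHom (k := k) {d} (C u) = C u := fun u => by rw [algHom_C, algebraMap_eq]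
  have off : ∀ {γ : Fin N → k}, linForm (Function.update γ d 0) = 0 → ∀ x, x ≠ d → γ x = 0 := by
    intro γ hγ x hx
    have := (linForm_eq_zero_iff _).1 hγ x
    rwa [Function.update_of_ne hx] at this
  have hXd0 : (X d : MvPolynomial (Fin N) k) ≠ 0 := X_ne_zero d
  -- the killed identity `A'^m B' = 0`
  have h1 : linForm (Function.update α d 0) ^ m * linForm (Function.update β d 0) = 0 := by
    have := congrArg (killHom (k := k) {d}) h
    rwa [map_mul, map_pow, killHom_linForm, killHom_linForm, map_mul, map_pow, hXd,
      zero_pow (by omega), mul_zero] at this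
  rcases mul_eq_zero.1 h1 with hA | hB
  · have hα : ∀ x, x ≠ d → α x = 0 := off (pow_eq_zero_iff (by omega) |>.1 hA)
    by_cases hαd : α d = 0
    · exact Or.inr (Or.inl fun x => if hx : x = d then hx ▸ hαd else hα x hx)
    · left
      rw [linForm_eq_C_mul_X hα, mul_pow, ← C_pow] at h
      have h2 : X d ^ m * (C (α d ^ m) * linForm β) = X d ^ m * (C c * X d) := by
        calc X d ^ m * (C (α d ^ m) * linForm β) = C (α d ^ m) * X d ^ m * linForm β := by ring
          _ = C c * X d ^ (m + 1) := h
          _ = X d ^ m * (C c * X d) := by ring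
      have h3 := congrArg (killHom (k := k) {d}) (mul_left_cancel₀ (pow_ne_zero m hXd0) h2)
      rw [map_mul, hC, killHom_linForm, map_mul, hXd, mul_zero] at h3
      rcases mul_eq_zero.1 h3 with h4 | h4
      · exact absurd (C_eq_zero.1 h4) (pow_ne_zero m hαd)
      · exact fun x hx => ⟨hα x hx, off h4 x hx⟩
  · have hβ : ∀ x, x ≠ d → β x = 0 := off hB
    by_cases hβd : β d = 0
    · exact Or.inr (Or.inr fun x => if hx : x = d then hx ▸ hβd else hβ x hx)
    · left
      rw [linForm_eq_C_mul_X hβ] at h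
      have h2 : X d * (C (β d) * linForm α ^ m) = X d * (C c * X d ^ m) := by
        calc X d * (C (β d) * linForm α ^ m) = linForm α ^ m * (C (β d) * X d) := by ring
          _ = C c * X d ^ (m + 1) := h
          _ = X d * (C c * X d ^ m) := by ring
      have h3 := congrArg (killHom (k := k) {d}) (mul_left_cancel₀ hXd0 h2)
      rw [map_mul, hC, map_pow, killHom_linForm, map_mul, map_pow, hXd, zero_pow (by omega), mul_zero] at h3
      rcases mul_eq_zero.1 h3 with h4 | h4
      · exact absurd (C_eq_zero.1 h4) hβd
      · exact fun x hx => ⟨off (pow_eq_zero_iff (by omega) |>.1 h4) x hx, hβ x hx⟩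

end Kill

/-! ## §8 Valuation calculus: orders of sums, units, parity of powers, low-degree components -/

section OrdTools

variable {σ : Type*} {w : σ → ℕ}

/-- **`ν(F + G) = ν G` when `ν G < ν F`** (the monomial valuation is non-archimedean).
[cite: AbramovichQuekSchober2024, §4 (v_J is a valuation)] -/
theorem monomialOrd_add_eq_of_lt {F G : MvPolynomial σ k} (h : monomialOrd w G < monomialOrd w F) :
    monomialOrd w (F + G) = monomialOrd w G := by
  unfold monomialOrd at h ⊢
  rw [MvPolynomial.coe_add, MvPowerSeries.weightedOrder_add_of_weightedOrder_ne w h.ne', inf_eq_right.2 h.le]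

/-- **`ν(F + G) ≤ ν G` is impossible to beat: if `ν(F+G) ≥ n` and `ν F ≠ ν G` then both are `≥ n`.**
(derived here) [cite: AbramovichQuekSchober2024, §4] -/
theorem le_monomialOrd_of_add_of_ne {F G : MvPolynomial σ k} {n : ℕ∞} (hn : n ≤ monomialOrd w (F + G))
    (hne : monomialOrd w F ≠ monomialOrd w G) : n ≤ monomialOrd w F ∧ n ≤ monomialOrd w G := by
  rcases lt_or_gt_of_ne hne with h | h
  · rw [add_comm, monomialOrd_add_eq_of_lt h] at hn
    exact ⟨hn, hn.trans h.le⟩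
  · rw [monomialOrd_add_eq_of_lt h] at hn
    exact ⟨hn.trans h.le, hn⟩

/-- `ν(C u · F) = ν F` for a non-zero scalar. [cite: AbramovichTemkinWlodarczyk2024, Rem. 5.2.3] -/
theorem monomialOrd_C_mul' {u : k} (hu : u ≠ 0) (F : MvPolynomial σ k) : monomialOrd w (C u * F) = monomialOrd w F :=
  monomialOrd_mul_of_constantCoeff_ne_zero w (by rwa [constantCoeff_C]) F

/-- `ν(−F) = ν F`. [cite: AbramovichTemkinWlodarczyk2024, Rem. 5.2.3] -/
theorem monomialOrd_neg' (F : MvPolynomial σ k) : monomialOrd w (-F) = monomialOrd w F := by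
  rw [show -F = C (-1) * F by rw [C_neg, C_1, neg_one_mul]]
  exact monomialOrd_C_mul' (neg_ne_zero.2 one_ne_zero) F

/-- `ν(F − G) = ν G` when `ν G < ν F`. [cite: AbramovichQuekSchober2024, §4] -/
theorem monomialOrd_sub_eq_of_lt {F G : MvPolynomial σ k} (h : monomialOrd w G < monomialOrd w F) :
    monomialOrd w (F - G) = monomialOrd w G := by
  rw [sub_eq_add_neg, monomialOrd_add_eq_of_lt (by rwa [monomialOrd_neg']), monomialOrd_neg']

/-- **Order from vanishing components**: if `in_n P = 0` for all `n < s` then `ord P ≥ s`.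
[cite: CossartJannsenSaito2020, §2.2 (p. 21)] -/
theorem le_monomialOrd_one_of_homogeneousComponent_eq_zero (P : MvPolynomial σ k) {s : ℕ}
    (h : ∀ n, n < s → homogeneousComponent n P = 0) : (s : ℕ∞) ≤ monomialOrd (fun _ => 1) P := by
  classical
  rw [le_monomialOrd_one_iff]
  intro d hd
  by_contra hlt
  push Not at hlt
  have := congrArg (coeff d) (h d.degree hlt)
  rw [coeff_homogeneousComponent, if_pos rfl, coeff_zero] at this
  exact (mem_support_iff.1 hd) this

/-- **Squares in characteristic `2` have no odd-degree components.** (derived here; Frobenius)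
[cite: Temkin2025, §1.2.2 (1) (p. 4) (inseparability phenomena in characteristic p)] -/
theorem homogeneousComponent_sq_eq_zero_of_odd (h2 : (2 : k) = 0) {n : ℕ} (hn : Odd n)
    (P : MvPolynomial (Fin N) k) : homogeneousComponent n (P ^ 2) = 0 := by
  classical
  have h2' : (2 : MvPolynomial (Fin N) k) = 0 := by
    rw [← map_ofNat (C : k →+* MvPolynomial (Fin N) k) 2, show (OfNat.ofNat 2 : k) = 0 from h2, map_zero]
  induction P using MvPolynomial.induction_on' with
  | monomial e c =>
    rw [monomial_pow, homogeneousComponent_of_mem (isHomogeneous_monomial (c ^ 2) rfl), if_neg]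
    rw [map_nsmul, smul_eq_mul]
    rintro rfl
    exact (Nat.not_even_iff_odd.2 hn) (even_two_mul _)
  | add p q hp hq =>
    have : (p + q) ^ 2 = p ^ 2 + q ^ 2 := by
      calc (p + q) ^ 2 = p ^ 2 + q ^ 2 + 2 * (p * q) := by ring
        _ = p ^ 2 + q ^ 2 := by rw [h2', zero_mul, add_zero]
    rw [this, map_add, hp, hq, add_zero]

/-- **Cubes in characteristic `3` have no components of degree prime to `3`.** (derived here; Frobenius)
[cite: Temkin2025, §1.2.2 (1) (p. 4)] -/
theorem homogeneousComponent_cube_eq_zero_of_not_dvd (h3 : (3 : k) = 0) {n : ℕ} (hn : ¬ 3 ∣ n)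
    (P : MvPolynomial (Fin N) k) : homogeneousComponent n (P ^ 3) = 0 := by
  classical
  have h3' : (3 : MvPolynomial (Fin N) k) = 0 := by
    rw [← map_ofNat (C : k →+* MvPolynomial (Fin N) k) 3, show (OfNat.ofNat 3 : k) = 0 from h3, map_zero]
  induction P using MvPolynomial.induction_on' with
  | monomial e c =>
    rw [monomial_pow, homogeneousComponent_of_mem (isHomogeneous_monomial (c ^ 3) rfl), if_neg]
    rw [map_nsmul, smul_eq_mul]
    rintro rfl
    exact hn (dvd_mul_right 3 _)
  | add p q hp hq =>
    have : (p + q) ^ 3 = p ^ 3 + q ^ 3 := by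
      calc (p + q) ^ 3 = p ^ 3 + q ^ 3 + 3 * (p ^ 2 * q + p * q ^ 2) := by ring
        _ = p ^ 3 + q ^ 3 := by rw [h3', zero_mul, add_zero]
    rw [this, map_add, hp, hq, add_zero]

/-- The two-level weights: `6p` on the heavy variable `X_d`, `6Mq` on every other variable — an integer
rescaling of the rational weights `(1/M, q/p)` of a candidate centre (construction, ours; the rational
weights are those of [cite: AbramovichTemkinWlodarczyk2024, §3.4 (p. 1570) (ℚ-weights of centres)]). -/
def heavyWeights (d : Fin N) (M p q : ℕ) : Fin N → ℕ := fun x => if x = d then 6 * p else 6 * M * q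

/-- The weight as a sum over all variables (plumbing). [folklore] -/
private theorem weight_eq_sum_univ' (w : Fin N → ℕ) (dd : Fin N →₀ ℕ) : Finsupp.weight w dd = ∑ x, dd x * w x := by
  rw [Finsupp.weight_apply, Finsupp.sum_fintype dd _ (fun _ => by simp)]
  simp only [smul_eq_mul]

/-- The monomial valuation as a sum over all variables (plumbing). [folklore] -/
private theorem monomialValuation_eq_sum_univ₆ (γ : Fin N → ℚ) (dd : Fin N →₀ ℕ) :
    monomialValuation γ dd = ∑ x, (dd x : ℚ) * γ x := by
  rw [monomialValuation, Finsupp.sum_fintype]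
  intro i; simp

/-- The `heavyWeights`-weight of a monomial (plumbing). [folklore] -/
private theorem weight_heavyWeights (d : Fin N) (M p q : ℕ) (dd : Fin N →₀ ℕ) :
    Finsupp.weight (heavyWeights d M p q) dd + 6 * M * q * dd d = 6 * p * dd d + 6 * M * q * dd.degree := by
  classical
  have hw : Finsupp.weight (heavyWeights d M p q) dd = ∑ x, dd x * heavyWeights d M p q x :=
    weight_eq_sum_univ' _ dd
  have hdeg : dd.degree = ∑ x, dd x := by
    rw [Finsupp.degree_apply]
    exact Finset.sum_subset (Finset.subset_univ _) fun x _ hx => Finsupp.notMem_support_iff.1 hx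
  have h1 : ∑ x ∈ Finset.univ.erase d, dd x * heavyWeights d M p q x = ∑ x ∈ Finset.univ.erase d, 6 * M * q * dd x :=
    Finset.sum_congr rfl fun x hx => by
      rw [heavyWeights, if_neg (Finset.ne_of_mem_erase hx), mul_comm]
  rw [hw, hdeg, ← Finset.add_sum_erase _ _ (Finset.mem_univ d), ← Finset.add_sum_erase _ dd (Finset.mem_univ d),
    h1, ← Finset.mul_sum, heavyWeights, if_pos rfl]
  ring

/-- **Low-degree monomials of large weight are powers of the heavy variable**: if `Mq < p`, a monomial
of degree `≤ M` and `heavyWeights`-weight `≥ 6Mp` is `X_d^M`. (derived here)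
[cite: AbramovichTemkinWlodarczyk2024, §5.1 (p. 1575) (monomials of J-order ≥ 1)] -/
theorem eq_single_of_le_weight_heavyWeights {d : Fin N} {M p q : ℕ} (hpq : M * q < p) {dd : Fin N →₀ ℕ}
    (hdeg : dd.degree ≤ M) (hw : 6 * M * p ≤ Finsupp.weight (heavyWeights d M p q) dd) :
    dd = Finsupp.single d M := by
  classical
  have key := weight_heavyWeights d M p q dd
  have hddd : dd d ≤ dd.degree := by
    by_cases hd : d ∈ dd.support
    · rw [Finsupp.degree_apply]; exact Finset.single_le_sum (fun _ _ => Nat.zero_le _) hd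
    · rw [Finsupp.notMem_support_iff.1 hd]; exact Nat.zero_le _
  -- `dd d = M = degree dd`
  have h1 : dd d = M := by
    by_contra hne
    have hlt : dd d < M := lt_of_le_of_ne (hddd.trans hdeg) hne
    -- weight ≤ 6p·dd_d + 6Mq·(M - dd_d) < 6Mp
    have : 6 * M * p + 6 * M * q * dd d ≤ 6 * p * dd d + 6 * M * q * M := by
      calc 6 * M * p + 6 * M * q * dd d ≤ Finsupp.weight (heavyWeights d M p q) dd + 6 * M * q * dd d := by omega
        _ = 6 * p * dd d + 6 * M * q * dd.degree := key
        _ ≤ 6 * p * dd d + 6 * M * q * M := by have := Nat.mul_le_mul_left (6 * M * q) hdeg; omega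
    zify at this hlt hpq
    nlinarith [mul_pos (sub_pos.2 hlt) (sub_pos.2 hpq)]
  have h2 : dd.degree = dd d := le_antisymm (h1 ▸ hdeg) hddd
  ext x
  by_cases hx : x = d
  · rw [hx, Finsupp.single_eq_same, h1]
  · rw [Finsupp.single_eq_of_ne hx]
    by_contra hx0
    have hxs : x ∈ dd.support := Finsupp.mem_support_iff.2 hx0
    have hle : dd x + dd d ≤ dd.degree := by
      by_cases hds : d ∈ dd.support
      · rw [Finsupp.degree_apply, ← Finset.add_sum_erase _ _ hds, add_comm]
        exact Nat.add_le_add_left (Finset.single_le_sum (fun _ _ => Nat.zero_le _)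
          (Finset.mem_erase.2 ⟨hx, hxs⟩)) _
      · rw [Finsupp.notMem_support_iff.1 hds, add_zero, Finsupp.degree_apply]
        exact Finset.single_le_sum (fun _ _ => Nat.zero_le _) hxs
    omega

/-- **Low-degree components of a polynomial of large two-level weight**: if `Mq < p` and
`ν_{heavyWeights}(P) ≥ 6Mp` then `in_n P = 0` for `n < M` and `in_M P = P_{X_d^M} · X_d^M`. (derived here)
[cite: AbramovichTemkinWlodarczyk2024, §5.1 (p. 1575); CossartJannsenSaito2020, §2.2 (p. 21)] -/
theorem homogeneousComponent_of_le_monomialOrd_heavyWeights {d : Fin N} {M p q : ℕ} (hpq : M * q < p)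
    {P : MvPolynomial (Fin N) k} (hP : ((6 * M * p : ℕ) : ℕ∞) ≤ monomialOrd (heavyWeights d M p q) P) :
    (∀ n, n < M → homogeneousComponent n P = 0) ∧
      homogeneousComponent M P = C (coeff (Finsupp.single d M) P) * X d ^ M := by
  classical
  rw [le_monomialOrd_iff] at hP
  have hsupp : ∀ dd ∈ P.support, dd.degree ≤ M → dd = Finsupp.single d M := fun dd hdd hdeg =>
    eq_single_of_le_weight_heavyWeights hpq hdeg (hP dd hdd)
  refine ⟨fun n hn => homogeneousComponent_eq_zero' n P fun dd hdd hdeg => ?_, ?_⟩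
  · have := hsupp dd hdd (hdeg ▸ hn.le)
    rw [this, Finsupp.degree_single] at hdeg
    omega
  · ext dd
    rw [coeff_homogeneousComponent, coeff_C_mul, coeff_X_pow]
    by_cases hdd : dd = Finsupp.single d M
    · rw [hdd, if_pos (Finsupp.degree_single _ _), if_pos rfl, mul_one]
    · rw [if_neg (Ne.symm hdd), mul_zero]
      split_ifs with hdeg
      · by_contra hne
        exact hdd (hsupp dd (mem_support_iff.2 hne) hdeg.le)
      · rfl

end OrdTools

/-! ## §9 The apex variable and the Jacobian rank argument, for a general germ with `in₂ f = X_i²` -/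

section ApexRank

/-- A polynomial in the span of the `X_m`, `m ∈ S`, has no `X_y`-coefficient for `y ∉ S` (plumbing).
[folklore] -/
private theorem coeff_single_eq_zero_of_mem_span₆ {S : Finset (Fin N)} {P : MvPolynomial (Fin N) k}
    (hP : P ∈ Submodule.span k ((fun m => (X m : MvPolynomial (Fin N) k)) '' (S : Set (Fin N))))
    {y : Fin N} (hy : y ∉ S) : coeff (Finsupp.single y 1) P = 0 := by
  classical
  induction hP using Submodule.span_induction with
  | mem x hx =>
    obtain ⟨m, hm, rfl⟩ := hx
    rw [coeff_X, if_neg]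
    intro h
    have := Finsupp.single_left_injective one_ne_zero h
    exact hy (this ▸ hm)
  | zero => simp
  | add x y _ _ hx hy => rw [coeff_add, hx, hy, add_zero]
  | smul a x _ hx => rw [coeff_smul, hx, smul_zero]

/-- **The apex variable is `X_i` to first order** — general form.  If `ord f = 2`, `in₂ f = X_i²`,
`δ(f; X_i) = δ`, and `(Ψ, γ)` is a centre for `f` with a unique weight `1/2` (at `a`) and all weights
`≤ 1/2`, then the linear part of `Ψ(X_a)` is `λ X_i` with `λ ≠ 0`. (derived here)
[cite: AbramovichTemkinWlodarczyk2024, proof of Thm. 5.3.1 (2)–(3) (p. 1578), Lemma 5.2.10 (p. 1577);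
CossartJannsenSaito2020, Def. 7.1 (p. 107) (directrix)] -/
theorem coeff_single_apex_of_initial {f : MvPolynomial (Fin N) k} {i : Fin N}
    (hord : monomialOrd (fun _ => 1) f = 2) (hin : homogeneousComponent 2 f = X i ^ 2) {δ : ℚ}
    (hδ : hironakaDelta {i} 2 f = ((δ : ℚ) : WithTop ℚ))
    {Ψ : MvPolynomial (Fin N) k ≃ₐ[k] MvPolynomial (Fin N) k} {γ : Fin N → ℚ} (hc : IsCentreFor f Ψ γ)
    {a : Fin N} (hγa : γ a = 1 / 2) (hle2 : ∀ m, γ m ≤ 1 / 2) (huniq : ∀ m, γ m = 1 / 2 → m = a) :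
    (∀ y, y ≠ i → coeff (Finsupp.single y 1) (Ψ (X a)) = 0) ∧
      coeff (Finsupp.single i 1) (Ψ (X a)) ≠ 0 := by
  classical
  have hτ : hironakaTau k {homogeneousComponent 2 f} = 1 := by rw [hin]; exact hironakaTau_X_pow i two_ne_zero
  have hinv : ((2 : ℕ) : ℚ)⁻¹ = 1 / 2 := by norm_num
  have hle' : ∀ m, γ m ≤ ((2 : ℕ) : ℚ)⁻¹ := fun m => by rw [hinv]; exact hle2 m
  have hfilt : (Finset.univ.filter fun m => γ m = ((2 : ℕ) : ℚ)⁻¹) = {a} := by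
    ext m
    simp only [Finset.mem_filter, Finset.mem_univ, true_and, Finset.mem_singleton, hinv]
    exact ⟨huniq m, fun h => h ▸ hγa⟩
  have hset : {m | γ m = ((2 : ℕ) : ℚ)⁻¹} = {a} := by
    ext m
    simp only [Set.mem_setOf_eq, Set.mem_singleton_iff, hinv]
    exact ⟨huniq m, fun h => h ▸ hγa⟩
  have h1 := directrix_eq_span_of_isCentreFor hord hc hle' (by rw [hfilt, Finset.card_singleton, hτ])
  rw [hset, Set.image_singleton] at h1
  have hFS : ∀ d ∈ (homogeneousComponent 2 f).support, ∀ y ∉ ({i} : Finset (Fin N)), d y = 0 := by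
    intro d hd y hy
    rw [hin, X_pow_eq_monomial, support_monomial, if_neg one_ne_zero, Finset.mem_singleton] at hd
    rw [hd, Finsupp.single_apply, if_neg]
    rintro rfl
    exact hy (Finset.mem_singleton_self _)
  have h2 := directrix_eq_comap_span_X hord two_pos (by rw [Finset.card_singleton, hτ]) hFS hδ
  rw [h2] at h1
  have hT1 : Submodule.span k ((fun m => (X m : MvPolynomial (Fin N) k)) '' ((({i} : Finset (Fin N)) :
      Set (Fin N)))) ≤ homogeneousSubmodule (Fin N) k 1 :=
    Submodule.span_le.mpr (by
      rintro _ ⟨m, _, rfl⟩; exact (mem_homogeneousSubmodule 1 _).mpr (isHomogeneous_X k m))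
  have hT2 : Submodule.span k {homogeneousComponent 1 (Ψ (X a))} ≤ homogeneousSubmodule (Fin N) k 1 :=
    Submodule.span_le.mpr (by
      intro x hx
      rw [Set.mem_singleton_iff] at hx
      rw [hx]
      exact homogeneousComponent_mem 1 _)
  have h3 := congrArg (Submodule.map (linearFormPolyₗ k)) h1
  rw [map_comap_linearFormPolyₗ k hT1, map_comap_linearFormPolyₗ k hT2] at h3
  have hmem : homogeneousComponent 1 (Ψ (X a)) ∈ Submodule.span k ((fun m => (X m : MvPolynomial (Fin N) k)) ''
      ((({i} : Finset (Fin N)) : Set (Fin N)))) := by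
    rw [h3]; exact Submodule.subset_span rfl
  have hD : ∀ y, y ≠ i → coeff (Finsupp.single y 1) (Ψ (X a)) = 0 := by
    intro y hy
    have := coeff_single_eq_zero_of_mem_span₆ hmem (show y ∉ ({i} : Finset (Fin N)) by simpa using hy)
    rwa [coeff_homogeneousComponent, if_pos (by simp [Finsupp.degree_single])] at this
  refine ⟨hD, ?_⟩
  have hmon : ∀ m, (((fun _ => 1 : Fin N → ℕ) m : ℕ) : ℕ∞) ≤ monomialOrd (fun _ => 1) (Ψ.symm (X m)) :=
    fun m => by
      rw [Nat.cast_one]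
      exact one_le_monomialOrd_one_of_constantCoeff_eq_zero _ (constantCoeff_symm_X_eq_zero_of_forall Ψ hc.1 m)
  have key := sum_jacobianBlock_symm_mul_jacobianBlock (fun _ : Fin N => (1 : ℕ)) (fun _ => Nat.one_pos) Ψ.symm
    hmon (i := a) (l := a) rfl
  rw [AlgEquiv.symm_symm, Finset.filter_true_of_mem (fun _ _ => rfl), if_pos rfl,
    Finset.sum_eq_single i (fun m _ hm => by rw [hD m hm, zero_mul]) (fun h => absurd (Finset.mem_univ _) h)]
    at key
  intro h0
  rw [h0, zero_mul] at key
  exact zero_ne_one key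

/-- **Jacobian rank obstruction**: for an automorphism `Ψ` fixing the origin, no set `F` of rows of the
Jacobian of `Ψ⁻¹` at `0` can be supported on fewer than `|F|` columns. (derived here)
[cite: AbramovichTemkinWlodarczyk2024, §3.4 (p. 1570) (regular parameters have independent differentials)] -/
theorem false_of_jacobian_rows_supported {Ψ : MvPolynomial (Fin N) k ≃ₐ[k] MvPolynomial (Fin N) k}
    (hΨ : ∀ m, constantCoeff (Ψ (X m)) = 0) (F S : Finset (Fin N)) (hcard : S.card < F.card)
    (hoff : ∀ s, s ∉ S → ∀ x ∈ F, coeff (Finsupp.single s 1) (Ψ.symm (X x)) = 0) : False := by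
  classical
  have hmon : ∀ m, (((fun _ => 1 : Fin N → ℕ) m : ℕ) : ℕ∞) ≤ monomialOrd (fun _ => 1) (Ψ (X m)) :=
    fun m => by
      rw [Nat.cast_one]
      exact one_le_monomialOrd_one_of_constantCoeff_eq_zero _ (hΨ m)
  have hentry : ∀ x ∈ F, ∀ y : Fin N,
      ∑ s ∈ S, coeff (Finsupp.single s 1) (Ψ.symm (X x)) * coeff (Finsupp.single y 1) (Ψ (X s)) =
        if x = y then 1 else 0 := by
    intro x hx y
    rw [Finset.sum_subset (Finset.subset_univ S) (fun s _ hs => by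
      rw [hoff s hs x hx, zero_mul])]
    have key := sum_jacobianBlock_symm_mul_jacobianBlock (fun _ : Fin N => (1 : ℕ))
      (fun _ => Nat.one_pos) Ψ hmon (i := x) (l := y) rfl
    rwa [Finset.filter_true_of_mem (fun _ _ => rfl)] at key
  let P : Matrix F S k := Matrix.of fun x s =>
    coeff (Finsupp.single (s : Fin N) 1) (Ψ.symm (X (x : Fin N)))
  let Q : Matrix S F k := Matrix.of fun s y =>
    coeff (Finsupp.single (y : Fin N) 1) (Ψ (X (s : Fin N)))
  have hPQ : P * Q = 1 := by
    ext x y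
    rw [Matrix.mul_apply, Matrix.one_apply]
    have h := hentry x x.2 y
    rw [← Finset.sum_coe_sort S] at h
    simp only [P, Q, Matrix.of_apply]
    rw [h]
    simp only [Subtype.ext_iff]
  have h1 : (1 : Matrix F F k).rank = F.card := by
    rw [Matrix.rank_one, Fintype.card_coe]
  have h2 : (P * Q).rank ≤ S.card :=
    (Matrix.rank_mul_le_left P Q).trans ((Matrix.rank_le_card_width P).trans
      (by rw [Fintype.card_coe]))
  rw [hPQ, h1] at h2
  omega

end ApexRank

/-! ## §10 The second vertex of the cube-umbrella -/

section SecondVertex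

variable {i j l e : Fin N} {m : ℕ}

/-- Slice `0` of a `SliceOrd` bound (plumbing). [folklore] -/
private theorem SliceOrd.coeff_zero_le {σ : Type*} {w : σ → ℕ} {α s : ℕ} {P : Polynomial (MvPolynomial σ k)}
    (h : SliceOrd w α s P) : (s : ℕ∞) ≤ monomialOrd w (P.coeff 0) := by
  simpa using h 0

/-- Slice `1` of a `SliceOrd` bound (plumbing). [folklore] -/
private theorem SliceOrd.coeff_one_le {σ : Type*} {w : σ → ℕ} {α s : ℕ} {P : Polynomial (MvPolynomial σ k)}
    (h : SliceOrd w α s P) : ((s - α : ℕ) : ℕ∞) ≤ monomialOrd w (P.coeff 1) := by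
  simpa using h 1

/-- Slice `2` of a `SliceOrd` bound (plumbing). [folklore] -/
private theorem SliceOrd.coeff_two_le {σ : Type*} {w : σ → ℕ} {α s : ℕ} {P : Polynomial (MvPolynomial σ k)}
    (h : SliceOrd w α s P) : ((s - 2 * α : ℕ) : ℕ∞) ≤ monomialOrd w (P.coeff 2) := h 2

/-- Coefficients of the normal form `C p₀ + C p₁ ε + C p₂ ε² + C p₃ ε³` (plumbing). [folklore] -/
private theorem coeff_normalForm₄ {R : Type*} [CommSemiring R] (p₀ p₁ p₂ p₃ : R) :
    (Polynomial.C p₀ + Polynomial.C p₁ * Polynomial.X + Polynomial.C p₂ * Polynomial.X ^ 2 +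
        Polynomial.C p₃ * Polynomial.X ^ 3).coeff 0 = p₀ ∧
    (Polynomial.C p₀ + Polynomial.C p₁ * Polynomial.X + Polynomial.C p₂ * Polynomial.X ^ 2 +
        Polynomial.C p₃ * Polynomial.X ^ 3).coeff 1 = p₁ ∧
    (Polynomial.C p₀ + Polynomial.C p₁ * Polynomial.X + Polynomial.C p₂ * Polynomial.X ^ 2 +
        Polynomial.C p₃ * Polynomial.X ^ 3).coeff 2 = p₂ := by
  simp only [Polynomial.coeff_add, Polynomial.coeff_C, Polynomial.coeff_C_mul_X, Polynomial.coeff_C_mul_X_pow]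
  simp

/-- **Second vertex, weight form.**  For `f = X_i² + X_j^m X_l + X_e³` (`i, j, l, e` distinct, spectators
allowed, `m ≥ 3`; `2 ≠ 0` in `k` or `m` even; `3 ≠ 0` in `k` or `3 ∤ m+1`) there is NO centre `(Ψ, γ)` —
`Ψ` ANY polynomial automorphism fixing the origin — with weights `γ a = 1/2`, `γ b = 1/3`, `γ d ≤ 1/(m+1)`
for some third variable `d`, and all other weights `≤ q/p` where `(m+1)q < p`. (derived here)
[cite: AbramovichTemkinWlodarczyk2024, Thm. 5.3.1 (2) (p. 1578), Lemma 5.2.6–5.2.10 (p. 1577), §3.4 (p. 1570);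
CossartJannsenSaito2020, Def. 7.1 (p. 107), §2.2 (p. 21); Temkin2025, §1.2.2 (1) (p. 4)] -/
theorem not_isCentreFor_umbrellaCube_vertex (hij : i ≠ j) (hil : i ≠ l) (hie : i ≠ e) (hjl : j ≠ l)
    (hje : j ≠ e) (hle : l ≠ e) (hm : 3 ≤ m) (hchar2 : (2 : k) ≠ 0 ∨ Even m)
    (hchar3 : (3 : k) ≠ 0 ∨ ¬ 3 ∣ m + 1)
    {Ψ : MvPolynomial (Fin N) k ≃ₐ[k] MvPolynomial (Fin N) k} {γ : Fin N → ℚ} {a b d : Fin N}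
    (hγa : γ a = 1 / 2) (hγb : γ b = 1 / 3) (hda : d ≠ a) (hdb : d ≠ b)
    (hγd : γ d ≤ 1 / ((m + 1 : ℕ) : ℚ)) {p q : ℕ} (hq : 0 < q) (hpq : (m + 1) * q < p)
    (hE : ∀ x, x ≠ a → x ≠ b → x ≠ d → γ x ≤ (q : ℚ) / p) :
    ¬ IsCentreFor (umbrellaCube k i j l e m) Ψ γ := by
  classical
  intro hc
  set f := umbrellaCube k i j l e m with hf
  obtain ⟨K, hK⟩ : ∃ K, (m + 1) * p = K := ⟨_, rfl⟩
  have hp0 : 0 < p := by omega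
  have hK6 : 6 * (m + 1) * p = 6 * K := by rw [← hK]; ring
  -- numerics on the weights
  have hM0 : (0 : ℚ) < ((m + 1 : ℕ) : ℚ) := by positivity
  have hM4 : (4 : ℚ) ≤ ((m + 1 : ℕ) : ℚ) := by exact_mod_cast (by omega : 4 ≤ m + 1)
  have hqp : (q : ℚ) / p < 1 / ((m + 1 : ℕ) : ℚ) := by
    rw [div_lt_div_iff₀ (by exact_mod_cast hp0) hM0, one_mul]
    calc (q : ℚ) * ((m + 1 : ℕ) : ℚ) = (((m + 1) * q : ℕ) : ℚ) := by push_cast; ring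
      _ < p := by exact_mod_cast hpq
  have hM14 : 1 / ((m + 1 : ℕ) : ℚ) ≤ 1 / 4 := one_div_le_one_div_of_le (by norm_num) hM4
  have hab : a ≠ b := by rintro rfl; rw [hγa] at hγb; norm_num at hγb
  have hother : ∀ x, x ≠ a → γ x ≤ 1 / 3 := by
    intro x hxa
    by_cases hxb : x = b
    · rw [hxb, hγb]
    by_cases hxd : x = d
    · rw [hxd]; linarith
    · linarith [hE x hxa hxb hxd]
  have hle2 : ∀ x, γ x ≤ 1 / 2 := by
    intro x
    by_cases hxa : x = a
    · rw [hxa, hγa]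
    · linarith [hother x hxa]
  have huniq : ∀ x, γ x = 1 / 2 → x = a := by
    intro x hx
    by_contra hxa
    linarith [hother x hxa]
  -- the apex variable: `lin Ψ(X_a) = λ X_i`, `λ ≠ 0`
  obtain ⟨hD, hLi⟩ := coeff_single_apex_of_initial (monomialOrd_umbrellaCube hil hie hjl (by omega))
    (homogeneousComponent_umbrellaCube (by omega)) (hironakaDelta_umbrellaCube hij hil hie hle (by omega))
    hc hγa hle2 huniq
  -- the restriction `ρ = κ ∘ Ψ⁻¹`, `κ` killing `X_a, X_b`
  set H : Finset (Fin N) := {a, b} with hH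
  obtain ⟨ρ, hρ⟩ : ∃ ρ : MvPolynomial (Fin N) k →ₐ[k] MvPolynomial (Fin N) k,
      ∀ P, ρ P = killHom H (Ψ.symm P) :=
    ⟨(killHom H).comp (Ψ.symm : MvPolynomial (Fin N) k →ₐ[k] MvPolynomial (Fin N) k), fun _ => rfl⟩
  have hρΨ : ∀ x, ρ (Ψ (X x)) = killHom H (X x) := fun x => by rw [hρ, AlgEquiv.symm_apply_apply]
  have hρa : ρ (Ψ (X a)) = 0 := by rw [hρΨ, killHom_X_of_mem (by simp [hH])]
  have hρb : ρ (Ψ (X b)) = 0 := by rw [hρΨ, killHom_X_of_mem (by simp [hH])]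
  have hρx : ∀ x, x ≠ a → x ≠ b → ρ (Ψ (X x)) = X x := fun x hxa hxb => by
    rw [hρΨ, killHom_X_of_not_mem (by simp [hH, hxa, hxb])]
  have hΨs0 : ∀ x, constantCoeff (Ψ.symm (X x)) = 0 := constantCoeff_symm_X_eq_zero_of_forall Ψ hc.1
  have hρ0 : ∀ P, constantCoeff (ρ P) = constantCoeff P := fun P => by
    rw [hρ, constantCoeff_killHom, constantCoeff_map_of_fix' Ψ.symm hΨs0]
  have hρ1 : ∀ P y, y ≠ a → y ≠ b → coeff (Finsupp.single y 1) (ρ P) = coeff (Finsupp.single y 1) (Ψ.symm P) := by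
    intro P y hya hyb
    rw [hρ, coeff_killHom_of_forall_eq_zero]
    intro x hx
    simp only [hH, Finset.mem_insert, Finset.mem_singleton] at hx
    rcases hx with rfl | rfl
    · exact Finsupp.single_eq_of_ne (Ne.symm hya)
    · exact Finsupp.single_eq_of_ne (Ne.symm hyb)
  set v' := Ψ (X a) with hv'
  set V := ρ (X i) with hV
  set W := ρ (X j) with hW
  set U := ρ (X l) with hU
  set Z := ρ (X e) with hZ
  set L := ρ (pderiv i v') with hL
  set A := ρ (pderiv e v') with hA
  have hV0 : constantCoeff V = 0 := by rw [hV, hρ0, constantCoeff_X]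
  have hW0 : constantCoeff W = 0 := by rw [hW, hρ0, constantCoeff_X]
  have hU0 : constantCoeff U = 0 := by rw [hU, hρ0, constantCoeff_X]
  have hZ0 : constantCoeff Z = 0 := by rw [hZ, hρ0, constantCoeff_X]
  have hL0 : constantCoeff L ≠ 0 := by rw [hL, hρ0, constantCoeff_pderiv']; exact hLi
  have hρv' : ρ v' = 0 := hρa
  -- integer weights: `6p` on `X_d`, `6(m+1)q` elsewhere; source weights `qs`
  obtain ⟨Wt, hWt⟩ : ∃ Wt : Fin N → ℕ, Wt = heavyWeights d (m + 1) p q := ⟨_, rfl⟩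
  have hWtle : ∀ x, Wt x ≤ 2 * K := by
    intro x
    rw [hWt, heavyWeights]
    split_ifs
    · nlinarith
    · nlinarith
  obtain ⟨qs, hqs⟩ : ∃ qs : Fin N → ℕ, ∀ x, qs x = if x = a then 3 * K else if x = b then 2 * K else Wt x :=
    ⟨_, fun _ => rfl⟩
  have hqsa : qs a = 3 * K := by rw [hqs, if_pos rfl]
  have hqsb : qs b = 2 * K := by rw [hqs, if_neg (Ne.symm hab), if_pos rfl]
  have hqsx : ∀ x, x ≠ a → x ≠ b → qs x = Wt x := fun x hxa hxb => by rw [hqs, if_neg hxa, if_neg hxb]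
  -- admissibility of `Ψ⁻¹ f` in the source weights
  have hqsγ : ∀ x, (6 * K : ℚ) * γ x ≤ (qs x : ℚ) := by
    intro x
    by_cases hxa : x = a
    · rw [hxa, hqsa, hγa]; push_cast; linarith
    by_cases hxb : x = b
    · rw [hxb, hqsb, hγb]; push_cast; linarith
    rw [hqsx x hxa hxb, hWt, heavyWeights]
    have hKq : (K : ℚ) = ((m + 1 : ℕ) : ℚ) * p := by rw [← hK]; push_cast; ring
    by_cases hxd : x = d
    · rw [if_pos hxd, hxd]
      calc (6 * K : ℚ) * γ d ≤ 6 * K * (1 / ((m + 1 : ℕ) : ℚ)) := mul_le_mul_of_nonneg_left hγd (by positivity)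
        _ = ((6 * p : ℕ) : ℚ) := by rw [hKq]; field_simp; push_cast; ring
    · rw [if_neg hxd]
      calc (6 * K : ℚ) * γ x ≤ 6 * K * ((q : ℚ) / p) := mul_le_mul_of_nonneg_left (hE x hxa hxb hxd) (by positivity)
        _ = ((6 * (m + 1) * q : ℕ) : ℚ) := by
          rw [hKq]; field_simp; push_cast; ring
  have hadm : ∀ dd ∈ (Ψ.symm f).support, 6 * K ≤ Finsupp.weight qs dd := by
    intro dd hdd
    have h1 : (1 : ℚ) ≤ ∑ x, (dd x : ℚ) * γ x := by
      rw [← monomialValuation_eq_sum_univ₆]; exact hc.2.2 dd hdd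
    have h2 : ((Finsupp.weight qs dd : ℕ) : ℚ) = ∑ x, (dd x : ℚ) * (qs x : ℚ) := by
      rw [weight_eq_sum_univ']; push_cast; rfl
    have h3 : ((6 * K : ℕ) : ℚ) ≤ ∑ x, (dd x : ℚ) * (qs x : ℚ) := by
      calc ((6 * K : ℕ) : ℚ) = (6 * K : ℚ) * 1 := by push_cast; ring
        _ ≤ (6 * K : ℚ) * ∑ x, (dd x : ℚ) * γ x := mul_le_mul_of_nonneg_left h1 (by positivity)
        _ = ∑ x, (dd x : ℚ) * ((6 * K : ℚ) * γ x) := by rw [Finset.mul_sum]; exact Finset.sum_congr rfl fun x _ => by ring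
        _ ≤ ∑ x, (dd x : ℚ) * (qs x : ℚ) :=
          Finset.sum_le_sum fun x _ => mul_le_mul_of_nonneg_left (hqsγ x) (by positivity)
    rw [← h2] at h3
    exact_mod_cast h3
  -- SliceOrd bounds for the generators, and the transfer to `f`
  have hgen : ∀ (ξ : Fin N → MvPolynomial (Fin N) k) (α : ℕ), 2 * K ≤ α →
      SliceOrd Wt α (3 * K) (fieldTaylorₐ ρ ξ v') → ∀ x, SliceOrd Wt α (qs x) (fieldTaylorₐ ρ ξ (Ψ (X x))) := by
    intro ξ α hα ha x
    by_cases hxa : x = a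
    · rw [hxa, hqsa]; exact ha
    have hq2 : qs x ≤ 2 * K := by
      by_cases hxb : x = b
      · rw [hxb, hqsb]
      · rw [hqsx x hxa hxb]; exact hWtle x
    refine sliceOrd_of_coeff ?_ ?_ (by omega)
    · rw [coeff_zero_fieldTaylorₐ]
      by_cases hxb : x = b
      · rw [hxb, hρb, monomialOrd_zero]; exact le_top
      · rw [hρx x hxa hxb, monomialOrd_X, hqsx x hxa hxb]
    · rw [Nat.sub_eq_zero_of_le (hq2.trans hα), Nat.cast_zero]; exact zero_le
  have hTf : ∀ (ξ : Fin N → MvPolynomial (Fin N) k) (α : ℕ), 2 * K ≤ α →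
      SliceOrd Wt α (3 * K) (fieldTaylorₐ ρ ξ v') → SliceOrd Wt α (6 * K) (fieldTaylorₐ ρ ξ f) := by
    intro ξ α hα ha
    have h := SliceOrd.map (φ := (fieldTaylorₐ ρ ξ).comp (Ψ : MvPolynomial (Fin N) k →ₐ[k] MvPolynomial (Fin N) k))
      qs (fun x => hgen ξ α hα ha x) (F := Ψ.symm f) hadm
    have h' : SliceOrd Wt α (6 * K) (fieldTaylorₐ ρ ξ (Ψ (Ψ.symm f))) := h
    rwa [AlgEquiv.apply_symm_apply] at h'
  -- (T1) the direction `∂_i`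
  set ξ₁ : Fin N → MvPolynomial (Fin N) k := fun x => if x = i then 1 else 0 with hξ₁
  have hT1 : SliceOrd Wt (3 * K) (6 * K) (fieldTaylorₐ ρ ξ₁ f) := by
    refine hTf ξ₁ (3 * K) (by omega) (sliceOrd_of_coeff ?_ ?_ (by omega))
    · rw [coeff_zero_fieldTaylorₐ, hρv', monomialOrd_zero]; exact le_top
    · rw [Nat.sub_self, Nat.cast_zero]; exact zero_le
  have hexp1 : fieldTaylorₐ ρ ξ₁ f = Polynomial.C (V ^ 2 + W ^ m * U + Z ^ 3) + Polynomial.C (2 * V) * Polynomial.X +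
      Polynomial.C 1 * Polynomial.X ^ 2 + Polynomial.C 0 * Polynomial.X ^ 3 := by
    have e1 : ξ₁ i = 1 := by simp [hξ₁]
    have e2 : ξ₁ j = 0 := by simp [hξ₁, hij.symm]
    have e3 : ξ₁ l = 0 := by simp [hξ₁, hil.symm]
    have e4 : ξ₁ e = 0 := by simp [hξ₁, hie.symm]
    rw [hf, umbrellaCube_eq]
    simp only [map_add, map_mul, map_pow, fieldTaylorₐ_X, e1, e2, e3, e4, map_one, map_zero, mul_zero, add_zero]
    simp only [map_ofNat]
    ring
  have hG : ((6 * K : ℕ) : ℕ∞) ≤ monomialOrd Wt (V ^ 2 + W ^ m * U + Z ^ 3) := by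
    have h := hT1.coeff_zero_le; rwa [hexp1, (coeff_normalForm₄ _ _ _ _).1] at h
  have hEv : ((3 * K : ℕ) : ℕ∞) ≤ monomialOrd Wt (2 * V) := by
    have h := hT1.coeff_one_le
    rwa [hexp1, (coeff_normalForm₄ _ _ _ _).2.1, show 6 * K - 3 * K = 3 * K by omega] at h
  -- (T2) the direction `ξ = (∂_i v') ∂_e − (∂_e v') ∂_i`, tangent to `v' = 0`
  set ξ₂ := pairField i e (-pderiv e v') (pderiv i v') with hξ₂
  have hT2 : SliceOrd Wt (2 * K) (6 * K) (fieldTaylorₐ ρ ξ₂ f) := by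
    refine hTf ξ₂ (2 * K) le_rfl (sliceOrd_of_coeff ?_ ?_ (by omega))
    · rw [coeff_zero_fieldTaylorₐ, hρv', monomialOrd_zero]; exact le_top
    · have hsum : ∑ x, ξ₂ x * pderiv x v' = 0 := by rw [hξ₂, sum_pairField_mul' hie]; ring
      rw [coeff_one_fieldTaylorₐ, hsum, map_zero, monomialOrd_zero]; exact le_top
  have hexp2 : fieldTaylorₐ ρ ξ₂ f = Polynomial.C (V ^ 2 + W ^ m * U + Z ^ 3) +
      Polynomial.C (3 * L * Z ^ 2 - A * (2 * V)) * Polynomial.X + Polynomial.C (A ^ 2 + 3 * L ^ 2 * Z) * Polynomial.X ^ 2 +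
      Polynomial.C (L ^ 3) * Polynomial.X ^ 3 := by
    have e1 : ξ₂ i = -pderiv e v' := by simp [hξ₂, pairField]
    have e2 : ξ₂ e = pderiv i v' := by simp [hξ₂, pairField, hie.symm]
    have e3 : ξ₂ j = 0 := by simp [hξ₂, pairField, hij.symm, hje]
    have e4 : ξ₂ l = 0 := by simp [hξ₂, pairField, hil.symm, hle]
    rw [hf, umbrellaCube_eq]
    simp only [map_add, map_mul, map_pow, fieldTaylorₐ_X, e1, e2, e3, e4, map_neg, map_zero, mul_zero, add_zero]
    simp only [map_sub, map_mul, map_pow, map_ofNat]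
    ring
  have hE1 : ((4 * K : ℕ) : ℕ∞) ≤ monomialOrd Wt (3 * L * Z ^ 2 - A * (2 * V)) := by
    have h := hT2.coeff_one_le
    rwa [hexp2, (coeff_normalForm₄ _ _ _ _).2.1, show 6 * K - 2 * K = 4 * K by omega] at h
  have hE2 : ((2 * K : ℕ) : ℕ∞) ≤ monomialOrd Wt (A ^ 2 + 3 * L ^ 2 * Z) := by
    have h := hT2.coeff_two_le
    rwa [hexp2, (coeff_normalForm₄ _ _ _ _).2.2, show 6 * K - 2 * (2 * K) = 2 * K by omega] at h
  -- (B) in characteristic `≠ 3`: `ord Z ≥ 2K`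
  have hZ2 : (3 : k) ≠ 0 → ((2 * K : ℕ) : ℕ∞) ≤ monomialOrd Wt Z := by
    intro h3
    by_contra hlt
    push Not at hlt
    obtain ⟨t, ht'⟩ := ENat.ne_top_iff_exists.1 hlt.ne_top
    have ht : monomialOrd Wt Z = t := ht'.symm
    have htK : t < 2 * K := by rw [ht] at hlt; exact_mod_cast hlt
    have hu3L : constantCoeff (3 * L) ≠ 0 := by
      rw [map_mul, map_ofNat]; exact mul_ne_zero h3 hL0
    have h1 : monomialOrd Wt (3 * L * Z ^ 2) = ((2 * t : ℕ) : ℕ∞) := by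
      rw [monomialOrd_mul_of_constantCoeff_ne_zero Wt hu3L, pow_two, monomialOrd_mul, ht, ← Nat.cast_add]
      congr 1; omega
    by_cases hs : monomialOrd Wt (A * (2 * V)) = monomialOrd Wt (3 * L * Z ^ 2)
    · rw [monomialOrd_mul, h1] at hs
      have hAtop : monomialOrd Wt A ≠ ⊤ := by
        intro htop; rw [htop, top_add] at hs; exact ENat.top_ne_coe _ hs
      have hVtop : monomialOrd Wt (2 * V) ≠ ⊤ := by
        intro htop; rw [htop, add_top] at hs; exact ENat.top_ne_coe _ hs
      obtain ⟨α', hα''⟩ := ENat.ne_top_iff_exists.1 hAtop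
      obtain ⟨β', hβ''⟩ := ENat.ne_top_iff_exists.1 hVtop
      have hα' : monomialOrd Wt A = α' := hα''.symm
      have hβ' : monomialOrd Wt (2 * V) = β' := hβ''.symm
      rw [hα', hβ', ← Nat.cast_add] at hs
      have hsum : α' + β' = 2 * t := by exact_mod_cast hs
      have hβ3 : 3 * K ≤ β' := by rw [hβ'] at hEv; exact_mod_cast hEv
      have h2 : monomialOrd Wt (A ^ 2) = ((2 * α' : ℕ) : ℕ∞) := by
        rw [pow_two, monomialOrd_mul, hα', ← Nat.cast_add]; congr 1; omega
      have hu3L2 : constantCoeff (3 * L ^ 2) ≠ 0 := by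
        rw [map_mul, map_pow, map_ofNat]; exact mul_ne_zero h3 (pow_ne_zero 2 hL0)
      have h3' : monomialOrd Wt (3 * L ^ 2 * Z) = t := by
        rw [monomialOrd_mul_of_constantCoeff_ne_zero Wt hu3L2, ht]
      have hlt2 : monomialOrd Wt (A ^ 2) < monomialOrd Wt (3 * L ^ 2 * Z) := by
        rw [h2, h3']; exact_mod_cast (by omega : 2 * α' < t)
      have hE2' := hE2
      rw [add_comm, monomialOrd_add_eq_of_lt hlt2, h2] at hE2'
      have : 2 * K ≤ 2 * α' := by exact_mod_cast hE2'
      omega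
    · have hE1' := hE1
      rcases lt_or_gt_of_ne hs with hlt' | hgt'
      · rw [monomialOrd_sub_eq_of_lt hlt'] at hE1'
        have h' := hE1'.trans hlt'.le
        rw [h1] at h'
        have : 4 * K ≤ 2 * t := by exact_mod_cast h'
        omega
      · rw [sub_eq_neg_add, monomialOrd_add_eq_of_lt (by rwa [monomialOrd_neg']), h1] at hE1'
        have : 4 * K ≤ 2 * t := by exact_mod_cast hE1'
        omega
  -- low-degree components: `in_M` of the three summands of `G = V² + W^m U + Z³` (`M = m + 1`)
  have hpq' : (m + 1) * q < p := hpq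
  have hVsq : ∃ κ : k, homogeneousComponent (m + 1) (V ^ 2) = C κ * X d ^ (m + 1) := by
    by_cases h2 : (2 : k) = 0
    · refine ⟨0, ?_⟩
      rw [C_0, zero_mul]
      have heven : Even m := hchar2.resolve_left (not_not.2 h2)
      exact homogeneousComponent_sq_eq_zero_of_odd h2 heven.add_one V
    · have hu2 : constantCoeff (2 : MvPolynomial (Fin N) k) ≠ 0 := by rwa [map_ofNat]
      have hV3 : ((3 * K : ℕ) : ℕ∞) ≤ monomialOrd Wt V := by
        rwa [monomialOrd_mul_of_constantCoeff_ne_zero Wt hu2] at hEv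
      have hV6 : ((6 * (m + 1) * p : ℕ) : ℕ∞) ≤ monomialOrd (heavyWeights d (m + 1) p q) (V ^ 2) := by
        rw [hK6, ← hWt, pow_two, show 6 * K = 3 * K + 3 * K by omega, Nat.cast_add]
        exact (add_le_add hV3 hV3).trans (add_monomialOrd_le_mul Wt V V)
      exact ⟨_, (homogeneousComponent_of_le_monomialOrd_heavyWeights hpq' hV6).2⟩
  have hZcube : ∃ κ : k, homogeneousComponent (m + 1) (Z ^ 3) = C κ * X d ^ (m + 1) := by
    by_cases h3 : (3 : k) = 0
    · refine ⟨0, ?_⟩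
      rw [C_0, zero_mul]
      exact homogeneousComponent_cube_eq_zero_of_not_dvd h3 (hchar3.resolve_left (not_not.2 h3)) Z
    · have hZ2' := hZ2 h3
      have hZ6 : ((6 * (m + 1) * p : ℕ) : ℕ∞) ≤ monomialOrd (heavyWeights d (m + 1) p q) (Z ^ 3) := by
        rw [hK6, ← hWt, pow_succ, pow_two, show 6 * K = 2 * K + 2 * K + 2 * K by omega, Nat.cast_add, Nat.cast_add]
        exact (add_le_add ((add_le_add hZ2' hZ2').trans (add_monomialOrd_le_mul Wt Z Z)) hZ2').trans
          (add_monomialOrd_le_mul Wt _ Z)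
      exact ⟨_, (homogeneousComponent_of_le_monomialOrd_heavyWeights hpq' hZ6).2⟩
  have hG' : ((6 * (m + 1) * p : ℕ) : ℕ∞) ≤ monomialOrd (heavyWeights d (m + 1) p q) (V ^ 2 + W ^ m * U + Z ^ 3) := by
    rw [hK6, ← hWt]; exact hG
  obtain ⟨hGlow, hGM⟩ := homogeneousComponent_of_le_monomialOrd_heavyWeights hpq' hG'
  -- degree-order bounds
  have hV1 : ((1 : ℕ) : ℕ∞) ≤ monomialOrd (fun _ => 1) V := by
    rw [Nat.cast_one]; exact one_le_monomialOrd_one_of_constantCoeff_eq_zero _ hV0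
  have hW1 : ((1 : ℕ) : ℕ∞) ≤ monomialOrd (fun _ => 1) W := by
    rw [Nat.cast_one]; exact one_le_monomialOrd_one_of_constantCoeff_eq_zero _ hW0
  have hU1 : ((1 : ℕ) : ℕ∞) ≤ monomialOrd (fun _ => 1) U := by
    rw [Nat.cast_one]; exact one_le_monomialOrd_one_of_constantCoeff_eq_zero _ hU0
  have hZ1 : ((1 : ℕ) : ℕ∞) ≤ monomialOrd (fun _ => 1) Z := by
    rw [Nat.cast_one]; exact one_le_monomialOrd_one_of_constantCoeff_eq_zero _ hZ0
  have hWm : ((m : ℕ) : ℕ∞) ≤ monomialOrd (fun _ => 1) (W ^ m) := by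
    have h := nsmul_monomialOrd_le_pow (fun _ => 1) W m
    refine le_trans ?_ h
    calc ((m : ℕ) : ℕ∞) = m • ((1 : ℕ) : ℕ∞) := by rw [Nat.cast_one, nsmul_one]
      _ ≤ m • monomialOrd (fun _ => 1) W := nsmul_le_nsmul_right hW1 m
  have hWU : ((m + 1 : ℕ) : ℕ∞) ≤ monomialOrd (fun _ => 1) (W ^ m * U) := by
    rw [Nat.cast_add]
    exact (add_le_add hWm hU1).trans (add_monomialOrd_le_mul _ _ _)
  have hZ3 : ((3 : ℕ) : ℕ∞) ≤ monomialOrd (fun _ => 1) (Z ^ 3) := by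
    have h := nsmul_monomialOrd_le_pow (fun _ => 1) Z 3
    refine le_trans ?_ h
    calc ((3 : ℕ) : ℕ∞) = 3 • ((1 : ℕ) : ℕ∞) := by rw [Nat.cast_one, nsmul_one]
      _ ≤ 3 • monomialOrd (fun _ => 1) Z := nsmul_le_nsmul_right hZ1 3
  -- `lin V = 0`
  have hlinV : homogeneousComponent 1 V = 0 := by
    have h2G := hGlow 2 (by omega)
    have hsq := homogeneousComponent_mul_pow_of_le_monomialOrd V hV1 2
    rw [Nat.mul_one] at hsq
    rw [map_add, map_add, hsq, homogeneousComponent_eq_zero_of_lt_monomialOrd _ (by omega : 2 < m + 1) hWU,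
      homogeneousComponent_eq_zero_of_lt_monomialOrd _ (by norm_num : 2 < 3) hZ3, add_zero, add_zero] at h2G
    exact pow_eq_zero_iff two_ne_zero |>.1 h2G
  have hV2 : ((2 : ℕ) : ℕ∞) ≤ monomialOrd (fun _ => 1) V := by
    refine le_monomialOrd_one_of_homogeneousComponent_eq_zero V fun n hn => ?_
    interval_cases n
    · rw [homogeneousComponent_zero, ← constantCoeff_eq, hV0, C_0]
    · exact hlinV
  -- `lin Z = 0`
  have hlinZ : homogeneousComponent 1 Z = 0 := by
    have h3G := hGlow 3 (by omega)
    have hcb := homogeneousComponent_mul_pow_of_le_monomialOrd Z hZ1 3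
    rw [Nat.mul_one] at hcb
    have hV4 : ((4 : ℕ) : ℕ∞) ≤ monomialOrd (fun _ => 1) (V ^ 2) := by
      rw [pow_two, show (4 : ℕ) = 2 + 2 from rfl, Nat.cast_add]
      exact (add_le_add hV2 hV2).trans (add_monomialOrd_le_mul _ V V)
    rw [map_add, map_add, hcb, homogeneousComponent_eq_zero_of_lt_monomialOrd _ (by omega : 3 < m + 1) hWU,
      homogeneousComponent_eq_zero_of_lt_monomialOrd _ (by norm_num : 3 < 4) hV4, zero_add, zero_add] at h3G
    exact pow_eq_zero_iff three_ne_zero |>.1 h3G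
  -- `(lin W)^m · lin U = κ X_d^{m+1}`
  obtain ⟨κV, hκV⟩ := hVsq
  obtain ⟨κZ, hκZ⟩ := hZcube
  have hprod : homogeneousComponent (m + 1) (W ^ m * U) = homogeneousComponent 1 W ^ m * homogeneousComponent 1 U := by
    have hpw := homogeneousComponent_mul_pow_of_le_monomialOrd W hW1 m
    rw [Nat.mul_one] at hpw
    rw [homogeneousComponent_add_mul_of_le_monomialOrd (W ^ m) U hWm hU1, hpw]
  set κG := coeff (Finsupp.single d (m + 1)) (V ^ 2 + W ^ m * U + Z ^ 3) with hκG
  have hstar : linForm (fun y => coeff (Finsupp.single y 1) W) ^ m * linForm (fun y => coeff (Finsupp.single y 1) U) =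
      C (κG - κV - κZ) * X d ^ (m + 1) := by
    rw [← homogeneousComponent_one_eq_linForm, ← homogeneousComponent_one_eq_linForm, ← hprod]
    rw [map_add, map_add, hκV, hκZ] at hGM
    have : homogeneousComponent (m + 1) (W ^ m * U) =
        C κG * X d ^ (m + 1) - C κV * X d ^ (m + 1) - C κZ * X d ^ (m + 1) := by
      rw [← hGM]; ring
    rw [this, map_sub, map_sub]; ring
  -- rows of the Jacobian of `Ψ⁻¹` at `0`
  have hrow : ∀ x s, s ≠ a → s ≠ b → coeff (Finsupp.single s 1) (ρ (X x)) = 0 →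
      coeff (Finsupp.single s 1) (Ψ.symm (X x)) = 0 := by
    intro x s hsa hsb h
    rwa [hρ1 (X x) s hsa hsb] at h
  have hrowV : ∀ s, coeff (Finsupp.single s 1) V = 0 := by
    have h := hlinV
    rw [homogeneousComponent_one_eq_linForm, linForm_eq_zero_iff] at h
    exact h
  have hrowZ : ∀ s, coeff (Finsupp.single s 1) Z = 0 := by
    have h := hlinZ
    rw [homogeneousComponent_one_eq_linForm, linForm_eq_zero_iff] at h
    exact h
  have hcardF3 : ∀ x y z : Fin N, x ≠ y → x ≠ z → y ≠ z → ({x, y, z} : Finset (Fin N)).card = 3 := by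
    intro x y z hxy hxz hyz
    rw [Finset.card_insert_of_notMem (by simp [hxy, hxz]), Finset.card_pair hyz]
  rcases linForm_trichotomy (by omega : 1 ≤ m) hstar with hboth | hWz | hUz
  · -- rows `i, j, l, e` supported on the columns `a, b, d`
    refine false_of_jacobian_rows_supported hc.1 {i, j, l, e} {a, b, d}
      (lt_of_le_of_lt Finset.card_le_three (by
        rw [Finset.card_insert_of_notMem (by simp [hij, hil, hie]), hcardF3 j l e hjl hje hle]; norm_num)) ?_
    intro s hs x hx
    simp only [Finset.mem_insert, Finset.mem_singleton, not_or] at hs hx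
    obtain ⟨hsa, hsb, hsd⟩ := hs
    refine hrow x s hsa hsb ?_
    rcases hx with rfl | rfl | rfl | rfl
    · exact hrowV s
    · exact (hboth s hsd).1
    · exact (hboth s hsd).2
    · exact hrowZ s
  · -- rows `i, j, e` supported on the columns `a, b`
    refine false_of_jacobian_rows_supported hc.1 {i, j, e} {a, b}
      (lt_of_le_of_lt Finset.card_le_two (by rw [hcardF3 i j e hij hie hje]; norm_num)) ?_
    intro s hs x hx
    simp only [Finset.mem_insert, Finset.mem_singleton, not_or] at hs hx
    obtain ⟨hsa, hsb⟩ := hs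
    refine hrow x s hsa hsb ?_
    rcases hx with rfl | rfl | rfl
    · exact hrowV s
    · exact hWz s
    · exact hrowZ s
  · -- rows `i, l, e` supported on the columns `a, b`
    refine false_of_jacobian_rows_supported hc.1 {i, l, e} {a, b}
      (lt_of_le_of_lt Finset.card_le_two (by rw [hcardF3 i l e hil hie hle]; norm_num)) ?_
    intro s hs x hx
    simp only [Finset.mem_insert, Finset.mem_singleton, not_or] at hs hx
    obtain ⟨hsa, hsb⟩ := hs
    refine hrow x s hsa hsb ?_
    rcases hx with rfl | rfl | rfl
    · exact hrowV s
    · exact hUz s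
    · exact hrowZ s

end SecondVertex

/-! ## §11 From weights to invariants: `max W = (2, 3, m+1, m+1)` -/

section Assembly

variable {i j l e : Fin N} {m : ℕ}

/-- Three distinct indices leave one outside any pair (plumbing). [folklore] -/
private theorem exists_ne_ne₂ {i j l : Fin N} (hij : i ≠ j) (hil : i ≠ l) (hjl : j ≠ l) (a b : Fin N) :
    ∃ d, d ≠ a ∧ d ≠ b := by
  by_cases hia : i = a
  · by_cases hjb : j = b
    · exact ⟨l, fun h => hil (hia.trans h.symm), fun h => hjl (hjb.trans h.symm)⟩
    · exact ⟨j, fun h => hij (hia.trans h.symm), hjb⟩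
  · by_cases hib : i = b
    · by_cases hja : j = a
      · exact ⟨l, fun h => hjl (hja.trans h.symm), fun h => hil (hib.trans h.symm)⟩
      · exact ⟨j, hja, fun h => hij (hib.trans h.symm)⟩
    · exact ⟨i, hia, hib⟩

/-- A rational `c > M` as a ratio `p/q` of naturals with `Mq < p` (plumbing). [folklore] -/
private theorem exists_ratio_of_lt {M : ℕ} {c : ℚ} (hMc : (M : ℚ) < c) :
    ∃ p q : ℕ, 0 < q ∧ M * q < p ∧ 1 / c = (q : ℚ) / p := by
  have hc0 : 0 < c := lt_of_le_of_lt (Nat.cast_nonneg M) hMc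
  have hnum : 0 < c.num := Rat.num_pos.2 hc0
  have hp : ((c.num.toNat : ℕ) : ℚ) = (c.num : ℚ) := by exact_mod_cast Int.toNat_of_nonneg hnum.le
  have key : c * c.den = c.num := Rat.mul_den_eq_num c
  refine ⟨c.num.toNat, c.den, c.den_pos, ?_, ?_⟩
  · have h : (M : ℚ) * c.den < c * c.den := mul_lt_mul_of_pos_right hMc (by exact_mod_cast c.den_pos)
    rw [key, ← hp] at h
    exact_mod_cast h
  · rw [hp, div_eq_div_iff hc0.ne' (by exact_mod_cast hnum.ne'), one_mul, mul_comm]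
    exact key.symm

/-- **Second vertex, invariant form**: no centre for `X_i² + X_j^m X_l + X_e³` has invariant
`(2, 3, t…)` with `(m+1, m+1) <_trunc t` — i.e. `t = ()`, or `t = (c₃, …)` with `c₃ > m+1`, or
`t = (m+1)`, or `t = (m+1, c₄, …)` with `c₄ > m+1` (`m ≥ 3`; `2 ≠ 0` in `k` or `m` even; `3 ≠ 0` in `k` or
`3 ∤ m+1`; ALL polynomial coordinate changes). (derived here)
[cite: AbramovichTemkinWlodarczyk2024, Thm. 5.3.1 (2) (p. 1578); Temkin2025, §1.2.2 (1) (p. 4)] -/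
theorem not_isCentreFor_umbrellaCube_of_exps (hij : i ≠ j) (hil : i ≠ l) (hie : i ≠ e) (hjl : j ≠ l)
    (hje : j ≠ e) (hle : l ≠ e) (hm : 3 ≤ m) (hchar2 : (2 : k) ≠ 0 ∨ Even m)
    (hchar3 : (3 : k) ≠ 0 ∨ ¬ 3 ∣ m + 1)
    {Ψ : MvPolynomial (Fin N) k ≃ₐ[k] MvPolynomial (Fin N) k} {γ : Fin N → ℚ} {t : List ℚ}
    (hexps : exps γ = (2 : ℚ) :: 3 :: t)
    (ht : ATW.TruncLex.lt [((m + 1 : ℕ) : ℚ), ((m + 1 : ℕ) : ℚ)] t) :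
    ¬ IsCentreFor (umbrellaCube k i j l e m) Ψ γ := by
  classical
  intro hc
  have hM0 : (0 : ℚ) < ((m + 1 : ℕ) : ℚ) := by positivity
  have hsorted : ((2 : ℚ) :: 3 :: t).Pairwise (· ≤ ·) := hexps ▸ exps_sorted γ
  have hts : t.Pairwise (· ≤ ·) := (List.pairwise_cons.1 (List.pairwise_cons.1 hsorted).2).2
  -- peel `a` and `b`
  obtain ⟨a, -, hγa, hta⟩ := exists_update_of_exps_eq_cons hexps
  obtain ⟨b, hγb0, hγb, htb⟩ := exists_update_of_exps_eq_cons hta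
  have hba : b ≠ a := by rintro rfl; rw [Function.update_self] at hγb0; exact hγb0 rfl
  rw [Function.update_of_ne hba] at hγb
  set γ₂ := Function.update (Function.update γ a 0) b 0 with hγ₂
  have hγ₂eq : ∀ x, x ≠ a → x ≠ b → γ₂ x = γ x := fun x hxa hxb => by
    rw [hγ₂, Function.update_of_ne hxb, Function.update_of_ne hxa]
  have hγ₂a : γ₂ a = 0 := by rw [hγ₂, Function.update_of_ne (Ne.symm hba), Function.update_self]
  have hγ₂b : γ₂ b = 0 := by rw [hγ₂, Function.update_self]
  have hγ₂nn : ∀ x, 0 ≤ γ₂ x := update_nonneg (update_nonneg hc.2.1 a) b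
  have hγa' : γ a = 1 / 2 := by rw [hγa, one_div]
  have hγb' : γ b = 1 / 3 := by rw [hγb, one_div]
  -- it suffices to produce the weight data of the core lemma
  suffices key : ∃ d, d ≠ a ∧ d ≠ b ∧ γ d ≤ 1 / ((m + 1 : ℕ) : ℚ) ∧
      ∃ c, ((m + 1 : ℕ) : ℚ) < c ∧ ∀ x, x ≠ a → x ≠ b → x ≠ d → γ x ≤ 1 / c by
    obtain ⟨d, hda, hdb, hγd, c, hMc, hE⟩ := key
    obtain ⟨p, q, hq, hpq, hcq⟩ := exists_ratio_of_lt hMc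
    exact not_isCentreFor_umbrellaCube_vertex hij hil hie hjl hje hle hm hchar2 hchar3 hγa' hγb' hda hdb hγd hq
      hpq (fun x hxa hxb hxd => hcq ▸ hE x hxa hxb hxd) hc
  have hzero : ∀ {δ : Fin N → ℚ}, exps δ = [] → ∀ x, δ x = 0 := by
    intro δ hδ x
    by_contra hx
    have := inv_mem_exps_of_ne_zero₆ hx
    rw [hδ] at this
    simp at this
  rcases t with _ | ⟨c₃, t'⟩
  · -- `t = ()`: all other weights vanish
    obtain ⟨d, hda, hdb⟩ := exists_ne_ne₂ hij hil hjl a b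
    have hz : ∀ x, x ≠ a → x ≠ b → γ x = 0 := fun x hxa hxb => by rw [← hγ₂eq x hxa hxb]; exact hzero htb x
    refine ⟨d, hda, hdb, by rw [hz d hda hdb]; positivity, ((m + 1 : ℕ) : ℚ) + 1, lt_add_one _,
      fun x hxa hxb _ => by rw [hz x hxa hxb]; positivity⟩
  · rw [ATW.TruncLex.cons_lt_cons] at ht
    rcases ht with hlt | ⟨heq, ht'⟩
    · -- `c₃ > m + 1`
      obtain ⟨d, hda, hdb⟩ := exists_ne_ne₂ hij hil hjl a b
      have hbound : ∀ x, x ≠ a → x ≠ b → γ x ≤ 1 / c₃ := fun x hxa hxb => by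
        rw [← hγ₂eq x hxa hxb]
        exact le_inv_of_exps_eq htb (hM0.trans hlt) (fun y hy => le_of_mem_of_pairwise₆ hts hy) hγ₂nn x
      exact ⟨d, hda, hdb, (hbound d hda hdb).trans (one_div_le_one_div_of_le hM0 hlt.le), c₃, hlt,
        fun x hxa hxb _ => hbound x hxa hxb⟩
    · -- `c₃ = m + 1`: peel `d`
      subst heq
      obtain ⟨d, hγd0, hγd, htd⟩ := exists_update_of_exps_eq_cons htb
      have hda : d ≠ a := by rintro rfl; exact hγd0 hγ₂a
      have hdb : d ≠ b := by rintro rfl; exact hγd0 hγ₂b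
      have hγd' : γ d = 1 / ((m + 1 : ℕ) : ℚ) := by rw [← hγ₂eq d hda hdb, hγd, one_div]
      have hγ₃eq : ∀ x, x ≠ a → x ≠ b → x ≠ d → Function.update γ₂ d 0 x = γ x := fun x hxa hxb hxd => by
        rw [Function.update_of_ne hxd, hγ₂eq x hxa hxb]
      have hγ₃nn : ∀ x, 0 ≤ Function.update γ₂ d 0 x := update_nonneg hγ₂nn d
      rcases t' with _ | ⟨c₄, t''⟩
      · -- `t = (m+1)`
        refine ⟨d, hda, hdb, hγd'.le, ((m + 1 : ℕ) : ℚ) + 1, lt_add_one _, fun x hxa hxb hxd => ?_⟩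
        rw [← hγ₃eq x hxa hxb hxd, hzero htd x]
        positivity
      · rw [ATW.TruncLex.cons_lt_cons] at ht'
        rcases ht' with hlt4 | ⟨-, hnil⟩
        · -- `t = (m+1, c₄, …)` with `c₄ > m+1`
          have hts' : (c₄ :: t'').Pairwise (· ≤ ·) := (List.pairwise_cons.1 hts).2
          refine ⟨d, hda, hdb, hγd'.le, c₄, hlt4, fun x hxa hxb hxd => ?_⟩
          rw [← hγ₃eq x hxa hxb hxd]
          exact le_inv_of_exps_eq htd (hM0.trans hlt4) (fun y hy => le_of_mem_of_pairwise₆ hts' hy) hγ₃nn x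
        · exact (ATW.TruncLex.not_nil_lt _ hnil).elim

/-- **`max W(X_i² + X_j^m X_l + X_e³) = (2, 3, m+1, m+1)`** in the cell's polynomial weighted-centre model
(`i, j, l, e` distinct, any number of spectator variables, `m ≥ 3`, ALL polynomial coordinate changes;
`2 ≠ 0` in `k` or `m` even, and `3 ≠ 0` in `k` or `3 ∤ m+1`): the invariant `(2, 3, m+1, m+1)` of the
coordinate centre `(X_i², X_e³, X_j^{m+1}, X_l^{m+1})` is attained and nothing in `W` exceeds it in the
truncated-lexicographic order. (derived here) Instrument of the Resolution Observatory — NOT a resolution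
theorem. [cite: AbramovichTemkinWlodarczyk2024, Thm. 5.3.1 (2) (p. 1578) (inv_p = max over admissible
centres); CossartJannsenSaito2020, Thm. 8.16 (p. 121); Temkin2025, §1.2.2 (1) (p. 4)] -/
theorem isMaxInv_umbrellaCube (hij : i ≠ j) (hil : i ≠ l) (hie : i ≠ e) (hjl : j ≠ l) (hje : j ≠ e)
    (hle : l ≠ e) (hm : 3 ≤ m) (hchar2 : (2 : k) ≠ 0 ∨ Even m) (hchar3 : (3 : k) ≠ 0 ∨ ¬ 3 ∣ m + 1) :
    IsMaxInv (admissibleInvariants (umbrellaCube k i j l e m))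
      [(2 : ℚ), 3, ((m + 1 : ℕ) : ℚ), ((m + 1 : ℕ) : ℚ)] := by
  refine ⟨umbrellaCube_inv_mem hij hil hie hjl hje hle (by omega), fun b hb => ?_⟩
  have hff := not_lt_of_mem_admissibleInvariants_umbrellaCube hij hil hie hjl hle (by omega) hb
  obtain ⟨Ψ, γ, hc, rfl⟩ := hb
  rcases hγ : exps γ with _ | ⟨b₁, _ | ⟨b₂, t⟩⟩
  · rw [hγ] at hff
    exact (hff (ATW.TruncLex.cons_lt_nil _ _)).elim
  · rw [hγ] at hff
    intro h
    rw [ATW.TruncLex.cons_lt_cons] at h hff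
    exact hff (h.imp id fun h2 => ⟨h2.1, ATW.TruncLex.cons_lt_nil _ _⟩)
  · rw [hγ] at hff
    intro h
    rw [ATW.TruncLex.cons_lt_cons, ATW.TruncLex.cons_lt_cons] at h hff
    rcases h with h1 | ⟨h1, h2 | ⟨h2, h3⟩⟩
    · exact hff (Or.inl h1)
    · exact hff (Or.inr ⟨h1, Or.inl h2⟩)
    · subst h1 h2
      exact not_isCentreFor_umbrellaCube_of_exps hij hil hie hjl hje hle hm hchar2 hchar3 hγ h3 hc

/-- **Census shape `v² + w⁶ u + z³`: `max W = (2, 3, 7, 7)` in EVERY characteristic** (`m = 6` is even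
and `3 ∤ 7`), for all polynomial coordinate changes and any number of spectators. (derived here)
Instrument — NOT a resolution theorem. [cite: AbramovichTemkinWlodarczyk2024, Thm. 5.3.1 (2) (p. 1578);
Temkin2025, §1.2.2 (1) (p. 4)] -/
theorem isMaxInv_umbrellaCube_six (hij : i ≠ j) (hil : i ≠ l) (hie : i ≠ e) (hjl : j ≠ l) (hje : j ≠ e)
    (hle : l ≠ e) :
    IsMaxInv (admissibleInvariants (umbrellaCube k i j l e 6)) [(2 : ℚ), 3, 7, 7] := by
  have h := isMaxInv_umbrellaCube (k := k) hij hil hie hjl hje hle (by norm_num : 3 ≤ 6)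
    (Or.inr (by decide)) (Or.inr (by decide))
  norm_num at h
  exact h

end Assembly

end Literature.AlgebraicGeometry.Resolution.WeightedBlowup
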